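import Mathlib.LinearAlgebra.Matrix.NonsingularInverse
import Mathlib.Data.ZMod.Basic
import Mathlib.Data.Nat.Prime.Int
import Literature.NumberTheory.QuadraticFields.BinaryQuadraticFormsClassNumber
import HarnessLib

/-!
# The classes of discriminant matrices `S_Δ` of QCM-orders: `Gl(2, ℤ)` base change `S_Δ[g] = g S_Δ ᵗg`, Runge's
# reduced matrices `0 ≤ 2Δ ≤ Δ₁ ≤ Δ₂`, finiteness `3Δ₁² ≤ 16d`, and the table of `h_QCM(d)`, `d ≤ 11`
# (Runge 1999, §1 p. 284, §6 p. 297 and Remark 14)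

Layer `Literature/AlgebraicGeometry/ModuliOfAbelianVarieties`, namespace
`Literature.AlgebraicGeometry.ModuliOfAbelianVarieties.SiegelModuli`; lane `lit-hodgefound` (Track 2 foundations
library, Layer A4), seat `lit-hodgefound-skel-4`, row **A4-68**, FILE 1 (of 2): the ARITHMETIC of Runge's
discriminant matrices. Rows A4-66/A4-67 attached to a pair `(q, q′)` of singular relations on the Siegel family of
principally polarised abelian surfaces the integer matrix `S_Δ = discMatrix q q′ = (Δ(q) Δ(q,q′); Δ(q,q′) Δ(q′))`
(`SiegelFamilyTwoHumbertSurfaces`), positive definite on `H_q ∩ H_{q′}`, with `d(ℤ[α, β]) = det(S_Δ)/4`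
(`SiegelFamilyHumbertPairOrder`). This file treats such matrices abstractly — symmetric integer `2 × 2` matrices
`S = (Δ₁ Δ; Δ Δ₂)` — and FILE 2 (`SiegelFamilyHumbertDiscriminantClasses`) carries the results back to the pairs
`(q, q′)` and to `𝔥₂`. Nothing here depends on the Siegel family: the imports are Mathlib, the tree's Gauss
reduction vocabulary `Literature/NumberTheory/QuadraticFields/BinaryQuadraticFormsClassNumber` (only its search
bound `BinQF.bndAux` is used) and `HarnessLib`.

## Source, verbatim (B. Runge, *Endomorphism rings of abelian surfaces and projective models of their moduli
## spaces*, Tohoku Math. J. 51 (1999) 283–303; held text `paper:doi-10-2748-tmj-1178224764`)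

* §1, p. 284 (chunk p0002): "… is positive definite. The discriminant of `R` is `d(R) = det(S_Δ)/4`. Changing the
  basis gives a similar matrix `S_Δ[g] = g S_Δ ᵗg` for some `g ∈ Gl(2, ℤ)`. This implies that QCM-orders are
  parametrized by certain classes of binary quadratic forms. The main result of this paper is to prove that the
  QCM-order uniquely determines the QCM-curve, if the QCM-order has a primitive discriminant matrix (i.e.,
  `g.c.d.(Δ(α), Δ(α, β), Δ(β)) = 1`)."
* §6, p. 297 (p0015): "The discriminant matrix `S_Δ = (Δ(α) Δ(α,β); Δ(α,β) Δ(β))` of a QCM-order `R` is called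
  primitive if `g.c.d.(Δ(α), Δ(α,β), Δ(β)) = 1`."
* §6, REMARK 14, p. 299 (p0017): "It would be interesting to have a formula for the number of discriminant forms
  of QCM-orders `h_QCM(d) = #{S_Δ = (Δ₁ Δ; Δ Δ₂) ; Δᵢ > 0, det S_Δ = 4d, Δ₁, Δ₂ ≡ 0, 1 (4)} mod Gl(2, ℤ)`, for
  the cardinality `h_QCM,primitive` of the subset of primitive classes and `h_QCM,simple` for the cardinality of
  the subset of simple classes. (A class is simple if it does not represent non-zero squares, and a class is
  primitive if the g.c.d. is `1`.) The first few values are given by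

  | `d`                  | 1 | 2 | 3 | 4 | 5 | 6 | 7 | 8 | 9 | 10 | 11 |
  |----------------------|---|---|---|---|---|---|---|---|---|----|----|
  | `h_QCM,primitive(d)` | 1 | 1 | 1 | 2 | 2 | 2 | 1 | 2 | 3 | 2  | 2  |
  | `h_QCM,simple(d)`    | 0 | 0 | 0 | 0 | 0 | 1 | 0 | 0 | 0 | 1  | 0  |
  | `h_QCM(d)`           | 1 | 1 | 2 | 3 | 2 | 2 | 2 | 3 | 3 | 2  | 3  |

  The computation is done by considering the reduced `S_Δ`, which we define by
  `0 ≤ Δ ≤ Δ₁/2 ≤ Δ₁ ≤ Δ₂ = (Δ² + 4d)/Δ₁`. Using the action of `Gl(2, ℤ)`, any `S_Δ` is similar to a reduced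
  matrix. There are only finitely many such reduced `S_Δ`, which follows from `3Δ₁² ≤ 16d`."

  OCR caveat (numbers, not adjectives): in the held scan the inequality chain defining "reduced" is garbled; it
  is read here as `0 ≤ 2Δ ≤ Δ₁ ≤ Δ₂` (`IsRungeReduced`). This reading was CONFIRMED before formalising by
  recomputing the whole table: the reduced admissible matrices of determinant `4d`, `d = 1, …, 11`, are
  `(1,0,4)`·`(1,0,8)`·`(1,0,12),(4,2,4)`·`(1,0,16),(4,0,4),(4,2,5)`·`(1,0,20),(4,0,5)`·`(1,0,24),(5,1,5)`·
  `(1,0,28),(4,2,8)`·`(1,0,32),(4,0,8),(4,2,9)`·`(1,0,36),(4,0,9),(5,2,8)`·`(1,0,40),(5,0,8)`·`(1,0,44),(4,2,12),(5,1,9)`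
  (as `(Δ₁, Δ, Δ₂)`; `qcmReducedList_eq` below, by `decide`), reproducing all `33` printed values; the two simple
  classes are `(5,1,5)` (`d = 6`) and `(5,0,8)` (`d = 10`) — `d = 6, 10` being the discriminants of the
  quaternion algebras of Hashimoto–Murabayashi's examples quoted on p. 283.

## What is proved (definitions with bodies + theorems; NO named fact, NO sorry, net debt 0)

* §1 `discBaseChange g S = g S ᵗg` (Runge's `S_Δ[g]`), `det_discBaseChange` (`det S[g] = det(g)² det S`), the
  explicit entries `discBaseChange_fin_two`, the `Gl(2, ℤ)`-equivalence `IsGLEquiv` (an equivalence relation: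
  `IsGLEquiv.refl/symm/trans`), the binary form `discBinForm S x y = Δ₁x² + 2Δxy + Δ₂y²` with
  **`discBinForm_discBaseChange`** (the values of `S[g]` are values of `S`) and `IsGLEquiv.exists_discBinForm_eq`
  (equivalent matrices represent the same integers); invariance of `det` (`IsGLEquiv.det_eq`).
* §2 Remark 14's conditions `IsDiscMatrix` (symmetric, `Δ₁, Δ₂ ≡ 0, 1 (4)`, `4 ∣ det`), the parity lemma
  `IsDiscMatrix.two_dvd_iff`, **`isDiscMatrix_iff_forall_emod_four`** (`⟺` symmetric and EVERY value of the form is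
  `≡ 0, 1 (4)`), hence **`IsGLEquiv.isDiscMatrix`** (class invariance); the content `discContent` /
  `IsPrimitiveDisc` ("primitive if the g.c.d. is `1`") with `IsGLEquiv.discContent_eq`; simplicity `IsSimpleDisc`
  ("does not represent non-zero squares") with `IsGLEquiv.isSimpleDisc_iff`.
* §3 `IsRungeReduced` (`0 ≤ 2Δ ≤ Δ₁ ≤ Δ₂`), `det_pos_of_isRungeReduced`, **`three_mul_sq_le_four_mul_det`**
  ("`3Δ₁² ≤ 16d`"), and **`exists_isGLEquiv_isRungeReduced`** ("Using the action of `Gl(2, ℤ)`, any `S_Δ` is similar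
  to a reduced matrix": every positive definite symmetric integer matrix; the classical descent).
* §4 UNIQUENESS of the reduced representative (what Runge's count presupposes; the classical statement for
  `Gl(2, ℤ)`): `le_discBinForm_of_isRungeReduced` (`Δ₁` is the minimum of the form), `snd_le_discBinForm_of_isRungeReduced`
  (`Δ₂ ≤ S[x, y]` whenever `y ≠ 0`), **`eq_of_isGLEquiv_of_isRungeReduced`**.
* §5 the enumeration: `IsQCMReduced d t` (reduced, admissible, `Δ₁ > 0`, `det = 4d`), the explicit list
  `qcmReducedList d` with **`mem_qcmReducedList_iff`** and `nodup_qcmReducedList`, the class numbers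
  `qcmClassNumber d := (qcmReducedList d).length`, `qcmPrimitiveClassNumber d`; **`existsUnique_isGLEquiv_of_isDiscMatrix`**
  (every admissible positive definite `S` with `det S = 4d` is `Gl(2,ℤ)`-equivalent to EXACTLY ONE listed matrix —
  so `qcmClassNumber d` is Runge's `h_QCM(d)`); the tables **`qcmClassNumber_table`** (`1 1 2 3 2 2 2 3 3 2 3`),
  **`qcmPrimitiveClassNumber_table`** (`1 1 1 2 2 2 1 2 3 2 2`) and `qcmReducedList_eq` (all eleven lists), by `decide`.
* §6 the simple classes: **`isSimpleDisc_five_one_five`** (`5x² + 2xy + 5y²` is never a non-zero square: descent at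
  `3`), **`isSimpleDisc_five_zero_eight`** (`5x² + 8y²`: descent at `5`), and **`isSimpleDisc_iff_of_mem_qcmReducedList`**:
  for `d ≤ 11` a listed class is simple iff it is one of these two (every other entry represents `1`, `4` or `9`)
  — the printed row `h_QCM,simple = 0 0 0 0 0 1 0 0 0 1 0`.

## Scope / deviations (numbers, not adjectives)

* `Gl(2, ℤ)`-classes and reduced representatives are formalised for ALL positive definite symmetric integer
  `2 × 2` matrices (Runge needs them for the admissible ones); `h_QCM(d)` is DEFINED as the number of reduced
  admissible matrices of determinant `4d` (as the tree defines `BinQF.classNumber` by counting reduced forms),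
  justified by existence AND uniqueness (§3–§5); it is tabulated for `d ≤ 11` only — no closed formula (Runge asks
  for one).
* "QCM-order" (an order of an indefinite quaternion algebra occurring as `End(X)`), Theorem 10 (conjugacy under
  `Γ₂` for primitive `S_Δ`), Corollary 12 and Example 13 are NOT formalised here; that every admissible `S` IS the
  discriminant matrix of a pair of singular relations (Runge's standard basis, p. 298) is FILE 2.
* Mathlib (pin of the tree) has `Matrix.det`, `Matrix.nonsing_inv`, `ZMod`, but no reduction theory of binary
  forms; the tree's `BinQF` (Cox §2.A, proper = `SL₂` equivalence of PRIMITIVE forms) is a different carrier — its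
  search bound `bndAux` is reused, its reduction theorem is not needed (the descent is re-run for `Gl₂` on matrices,
  where primitivity plays no role).

## References

* [Runge1999EndomorphismRingsAbelianSurfaces] B. Runge, Tohoku Math. J. 51 (1999) 283–303: §1 p. 284, §6 p. 297,
  Remark 14 p. 299.
* [Cox2013] D. A. Cox, *Primes of the form x² + ny²*, 2nd ed. (2013), §2.A Thm. 2.8 (reduction; the model of §3–§4).
* [HashimotoMurabayashi1995] K. Hashimoto, N. Murabayashi, Tohoku Math. J. 47 (1995) (discriminants `6`, `10`;
  quoted through Runge p. 283).
-/

namespace Literature.AlgebraicGeometry.ModuliOfAbelianVarieties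

namespace SiegelModuli

open Matrix

/-- `2 × 2` integer matrices (file-local notation). -/
local notation "M₂ℤ" => Matrix (Fin 2) (Fin 2) ℤ

/-! ## §1 Base change `S_Δ[g] = g S_Δ ᵗg`, `Gl(2, ℤ)`-equivalence, the binary form `S[x, y]` -/

section BaseChange

/-- **Runge's base change of a discriminant matrix: `S_Δ[g] = g S_Δ ᵗg`** ("Changing the basis gives a similar
matrix `S_Δ[g] = g S_Δ ᵗg` for some `g ∈ Gl(2, ℤ)`"). [cite: Runge1999EndomorphismRingsAbelianSurfaces, §1 p. 284] -/
def discBaseChange (g S : M₂ℤ) : M₂ℤ := g * S * gᵀ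

variable (g h S : M₂ℤ)

/-- Unfolding of `discBaseChange`. [cite: Runge1999EndomorphismRingsAbelianSurfaces, §1 p. 284] -/
theorem discBaseChange_apply : discBaseChange g S = g * S * gᵀ := rfl

/-- `S[1] = S`. [cite: Runge1999EndomorphismRingsAbelianSurfaces, §1 p. 284] -/
@[simp] theorem discBaseChange_one : discBaseChange 1 S = S := by
  simp [discBaseChange]

/-- `S[gh] = (S[h])[g]` (a left action). [cite: Runge1999EndomorphismRingsAbelianSurfaces, §1 p. 284] -/
theorem discBaseChange_mul : discBaseChange (g * h) S = discBaseChange g (discBaseChange h S) := by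
  simp only [discBaseChange, Matrix.transpose_mul, Matrix.mul_assoc]

/-- `S[g]` is symmetric when `S` is. [cite: Runge1999EndomorphismRingsAbelianSurfaces, §1 p. 284] -/
theorem transpose_discBaseChange (hS : Sᵀ = S) : (discBaseChange g S)ᵀ = discBaseChange g S := by
  simp only [discBaseChange, Matrix.transpose_mul, Matrix.transpose_transpose, hS, Matrix.mul_assoc]

/-- **`det S[g] = det(g)² · det S`.** [cite: Runge1999EndomorphismRingsAbelianSurfaces, §1 p. 284] -/
theorem det_discBaseChange : (discBaseChange g S).det = g.det ^ 2 * S.det := by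
  simp only [discBaseChange, Matrix.det_mul, Matrix.det_transpose]; ring

/-- The entries of `S[g]` for a symmetric `S = (a b; b c)` and `g = (x y; z w)`:
`(ax² + 2bxy + cy², axz + b(xw + yz) + cyw; ·, az² + 2bzw + cw²)`. [cite: Runge1999EndomorphismRingsAbelianSurfaces, §1 p. 284] -/
theorem discBaseChange_fin_two (a b c x y z w : ℤ) :
    discBaseChange !![x, y; z, w] !![a, b; b, c] =
      !![a * x ^ 2 + 2 * b * x * y + c * y ^ 2, a * x * z + b * (x * w + y * z) + c * y * w;
         a * x * z + b * (x * w + y * z) + c * y * w, a * z ^ 2 + 2 * b * z * w + c * w ^ 2] := by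
  ext i j
  fin_cases i <;> fin_cases j <;>
    simp [discBaseChange, Matrix.mul_apply, Fin.sum_univ_two] <;> ring

/-- A symmetric `2 × 2` integer matrix is `(a b; b c)` with `a = S₀₀`, `b = S₀₁`, `c = S₁₁` (matrix extensionality). [folklore] -/
private theorem eq_of_symm {S : M₂ℤ} (hS : S 1 0 = S 0 1) : S = !![S 0 0, S 0 1; S 0 1, S 1 1] := by
  ext i j; fin_cases i <;> fin_cases j <;> simp [hS]

/-- Entries of `S[g]` for symmetric `S` (general `g`). [cite: Runge1999EndomorphismRingsAbelianSurfaces, §1 p. 284] -/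
theorem discBaseChange_apply_of_symm {S : M₂ℤ} (hS : S 1 0 = S 0 1) (g : M₂ℤ) :
    discBaseChange g S =
      !![S 0 0 * g 0 0 ^ 2 + 2 * S 0 1 * g 0 0 * g 0 1 + S 1 1 * g 0 1 ^ 2,
          S 0 0 * g 0 0 * g 1 0 + S 0 1 * (g 0 0 * g 1 1 + g 0 1 * g 1 0) + S 1 1 * g 0 1 * g 1 1;
         S 0 0 * g 0 0 * g 1 0 + S 0 1 * (g 0 0 * g 1 1 + g 0 1 * g 1 0) + S 1 1 * g 0 1 * g 1 1,
          S 0 0 * g 1 0 ^ 2 + 2 * S 0 1 * g 1 0 * g 1 1 + S 1 1 * g 1 1 ^ 2] := by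
  have hg : g = !![g 0 0, g 0 1; g 1 0, g 1 1] := by
    ext i j; fin_cases i <;> fin_cases j <;> rfl
  conv_lhs => rw [eq_of_symm hS, hg]
  rw [discBaseChange_fin_two]

/-- `S[g]` of a symmetric `S` is symmetric (entrywise form). [cite: Runge1999EndomorphismRingsAbelianSurfaces, §1 p. 284] -/
theorem discBaseChange_symm {S : M₂ℤ} (hS : S 1 0 = S 0 1) (g : M₂ℤ) :
    discBaseChange g S 1 0 = discBaseChange g S 0 1 := by
  rw [discBaseChange_apply_of_symm hS]; simp

/-- **`Gl(2, ℤ)`-equivalence of discriminant matrices: `S′ = S[g]` for some integer `g` with `det g = ±1`**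
("… mod `Gl(2, ℤ)`"). [cite: Runge1999EndomorphismRingsAbelianSurfaces, §1 p. 284 and Remark 14 (p. 299)] -/
def IsGLEquiv (S S' : M₂ℤ) : Prop := ∃ g : M₂ℤ, IsUnit g.det ∧ discBaseChange g S = S'

/-- Reflexivity. [cite: Runge1999EndomorphismRingsAbelianSurfaces, Remark 14 (p. 299)] -/
theorem IsGLEquiv.refl (S : M₂ℤ) : IsGLEquiv S S := ⟨1, by simp, discBaseChange_one S⟩

/-- Transitivity. [cite: Runge1999EndomorphismRingsAbelianSurfaces, Remark 14 (p. 299)] -/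
theorem IsGLEquiv.trans {S S' S'' : M₂ℤ} (h₁ : IsGLEquiv S S') (h₂ : IsGLEquiv S' S'') : IsGLEquiv S S'' := by
  obtain ⟨g, hg, rfl⟩ := h₁
  obtain ⟨g', hg', rfl⟩ := h₂
  exact ⟨g' * g, by rw [Matrix.det_mul]; exact hg'.mul hg, discBaseChange_mul g' g S⟩

/-- Symmetry (`g⁻¹` is again integral with `det = ±1`). [cite: Runge1999EndomorphismRingsAbelianSurfaces, Remark 14 (p. 299)] -/
theorem IsGLEquiv.symm {S S' : M₂ℤ} (h : IsGLEquiv S S') : IsGLEquiv S' S := by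
  obtain ⟨g, hg, rfl⟩ := h
  refine ⟨g⁻¹, Matrix.isUnit_nonsing_inv_det g hg, ?_⟩
  rw [← discBaseChange_mul, Matrix.nonsing_inv_mul g hg, discBaseChange_one]

/-- `IsGLEquiv S S′ ↔ IsGLEquiv S′ S`. [cite: Runge1999EndomorphismRingsAbelianSurfaces, Remark 14 (p. 299)] -/
theorem isGLEquiv_comm {S S' : M₂ℤ} : IsGLEquiv S S' ↔ IsGLEquiv S' S := ⟨IsGLEquiv.symm, IsGLEquiv.symm⟩

/-- `det g = ±1 ⟹ det(g)² = 1` (units of `ℤ`). [folklore] -/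
private theorem det_sq_eq_one {g : M₂ℤ} (hg : IsUnit g.det) : g.det ^ 2 = 1 := by
  rcases Int.isUnit_iff.1 hg with h | h <;> simp [h]

/-- **`det` is a class invariant** (`det g = ±1`). [cite: Runge1999EndomorphismRingsAbelianSurfaces, Remark 14 (p. 299: "`det S_Δ = 4d` … mod `Gl(2, ℤ)`")] -/
theorem IsGLEquiv.det_eq {S S' : M₂ℤ} (h : IsGLEquiv S S') : S'.det = S.det := by
  obtain ⟨g, hg, rfl⟩ := h
  rw [det_discBaseChange, det_sq_eq_one hg, one_mul]

/-- Equivalent symmetric matrices: `S′` is symmetric when `S` is. [cite: Runge1999EndomorphismRingsAbelianSurfaces, §1 p. 284] -/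
theorem IsGLEquiv.symm_apply {S S' : M₂ℤ} (h : IsGLEquiv S S') (hS : S 1 0 = S 0 1) : S' 1 0 = S' 0 1 := by
  obtain ⟨g, -, rfl⟩ := h; exact discBaseChange_symm hS g

/-- **The binary form of a discriminant matrix: `S[x, y] = Δ₁x² + 2Δxy + Δ₂y²`** (for `S = S_Δ(q, q′)` this is
`Δ(xq + yq′)`, rows A4-66 FILE 3 / A4-67 FILE 3 `discForm₂`; "the discriminant form … represents").
[cite: Runge1999EndomorphismRingsAbelianSurfaces, Remark 14 (p. 299: "A class is simple if it does not represent non-zero squares")] -/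
def discBinForm (S : M₂ℤ) (x y : ℤ) : ℤ := S 0 0 * x ^ 2 + 2 * S 0 1 * x * y + S 1 1 * y ^ 2

/-- Unfolding of `discBinForm`. [cite: Runge1999EndomorphismRingsAbelianSurfaces, Remark 14 (p. 299)] -/
theorem discBinForm_apply (S : M₂ℤ) (x y : ℤ) :
    discBinForm S x y = S 0 0 * x ^ 2 + 2 * S 0 1 * x * y + S 1 1 * y ^ 2 := rfl

/-- `S[1, 0] = Δ₁`. [cite: Runge1999EndomorphismRingsAbelianSurfaces, Remark 14 (p. 299)] -/
@[simp] theorem discBinForm_one_zero (S : M₂ℤ) : discBinForm S 1 0 = S 0 0 := by simp [discBinForm]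

/-- `S[0, 1] = Δ₂`. [cite: Runge1999EndomorphismRingsAbelianSurfaces, Remark 14 (p. 299)] -/
@[simp] theorem discBinForm_zero_one (S : M₂ℤ) : discBinForm S 0 1 = S 1 1 := by simp [discBinForm]

/-- `S[1, 1] = Δ₁ + 2Δ + Δ₂`. [cite: Runge1999EndomorphismRingsAbelianSurfaces, Remark 14 (p. 299)] -/
theorem discBinForm_one_one (S : M₂ℤ) : discBinForm S 1 1 = S 0 0 + 2 * S 0 1 + S 1 1 := by
  simp [discBinForm]

/-- Homogeneity: `S[nx, ny] = n² S[x, y]`. [cite: Runge1999EndomorphismRingsAbelianSurfaces, Remark 14 (p. 299)] -/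
theorem discBinForm_smul (S : M₂ℤ) (n x y : ℤ) : discBinForm S (n * x) (n * y) = n ^ 2 * discBinForm S x y := by
  simp only [discBinForm]; ring

/-- The diagonal entries of `S[g]` are values of the form: `S[g]₀₀ = S[g₀₀, g₀₁]`. [cite: Runge1999EndomorphismRingsAbelianSurfaces, §1 p. 284] -/
theorem discBaseChange_zero_zero {S : M₂ℤ} (hS : S 1 0 = S 0 1) (g : M₂ℤ) :
    discBaseChange g S 0 0 = discBinForm S (g 0 0) (g 0 1) := by
  rw [discBaseChange_apply_of_symm hS, discBinForm]
  simp

/-- `S[g]₁₁ = S[g₁₀, g₁₁]`. [cite: Runge1999EndomorphismRingsAbelianSurfaces, §1 p. 284] -/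
theorem discBaseChange_one_one' {S : M₂ℤ} (hS : S 1 0 = S 0 1) (g : M₂ℤ) :
    discBaseChange g S 1 1 = discBinForm S (g 1 0) (g 1 1) := by
  rw [discBaseChange_apply_of_symm hS, discBinForm]
  simp

/-- **The values of `S[g]` are values of `S`: `S[g][x, y] = S[ᵗg (x, y)]`.** [cite: Runge1999EndomorphismRingsAbelianSurfaces, §1 p. 284 and Remark 14 (p. 299)] -/
theorem discBinForm_discBaseChange {S : M₂ℤ} (hS : S 1 0 = S 0 1) (g : M₂ℤ) (x y : ℤ) :
    discBinForm (discBaseChange g S) x y =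
      discBinForm S (x * g 0 0 + y * g 1 0) (x * g 0 1 + y * g 1 1) := by
  rw [discBaseChange_apply_of_symm hS]
  simp only [discBinForm, Matrix.of_apply, Matrix.cons_val', Matrix.cons_val_zero, Matrix.cons_val_one,
    Matrix.empty_val', Matrix.cons_val_fin_one]
  ring

/-- **Equivalent matrices represent the same integers.** [cite: Runge1999EndomorphismRingsAbelianSurfaces, Remark 14 (p. 299)] -/
theorem IsGLEquiv.exists_discBinForm_eq {S S' : M₂ℤ} (h : IsGLEquiv S S') (hS : S 1 0 = S 0 1) (x y : ℤ) :
    ∃ x' y', discBinForm S x' y' = discBinForm S' x y := by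
  obtain ⟨g, -, rfl⟩ := h
  exact ⟨_, _, (discBinForm_discBaseChange hS g x y).symm⟩

/-- For `det g = ±1` the substitution `(x, y) ↦ ᵗg(x, y)` hits every integer vector: the values of `S` are values
of `S[g]` too. [cite: Runge1999EndomorphismRingsAbelianSurfaces, Remark 14 (p. 299)] -/
theorem IsGLEquiv.exists_discBinForm_eq' {S S' : M₂ℤ} (h : IsGLEquiv S S') (hS : S 1 0 = S 0 1) (x y : ℤ) :
    ∃ x' y', discBinForm S' x' y' = discBinForm S x y :=
  h.symm.exists_discBinForm_eq (h.symm_apply hS) x y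

/-- A non-zero vector stays non-zero under `ᵗg`, `det g = ±1` (invertible integer matrices). [folklore] -/
private theorem vec_ne_zero_of_isUnit {g : M₂ℤ} (hg : IsUnit g.det) {x y : ℤ} (hxy : ¬ (x = 0 ∧ y = 0)) :
    ¬ (x * g 0 0 + y * g 1 0 = 0 ∧ x * g 0 1 + y * g 1 1 = 0) := by
  rintro ⟨h1, h2⟩
  have hdet : g.det = g 0 0 * g 1 1 - g 0 1 * g 1 0 := Matrix.det_fin_two g
  have hx : x * g.det = 0 := by rw [hdet]; linear_combination g 1 1 * h1 - g 1 0 * h2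
  have hy : y * g.det = 0 := by rw [hdet]; linear_combination g 0 0 * h2 - g 0 1 * h1
  have hd : g.det ≠ 0 := hg.ne_zero
  exact hxy ⟨(mul_eq_zero.1 hx).resolve_right hd, (mul_eq_zero.1 hy).resolve_right hd⟩

end BaseChange

/-! ## §2 Remark 14's conditions: symmetric, `Δ₁, Δ₂ ≡ 0, 1 (4)`, `4 ∣ det`; content; simplicity -/

section Admissible

/-- **Runge's discriminant matrices** — the set counted in Remark 14: symmetric integer matrices
`S_Δ = (Δ₁ Δ; Δ Δ₂)` with `Δ₁, Δ₂ ≡ 0, 1 (4)` and `det S_Δ = Δ₁Δ₂ − Δ² ≡ 0 (4)` ("`det S_Δ = 4d, Δ₁, Δ₂ ≡ 0, 1 (4)`").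
Positivity (`Δᵢ > 0`) and the value of `d` are kept as separate hypotheses. FILE 2 shows these are EXACTLY the
matrices `S_Δ(q, q′)` of pairs of singular relations. [cite: Runge1999EndomorphismRingsAbelianSurfaces, Remark 14 (p. 299)] -/
structure IsDiscMatrix (S : M₂ℤ) : Prop where
  /-- `S` is symmetric -/
  symm : S 1 0 = S 0 1
  /-- `Δ₁ ≡ 0, 1 (mod 4)` -/
  fst_emod_four : S 0 0 % 4 = 0 ∨ S 0 0 % 4 = 1
  /-- `Δ₂ ≡ 0, 1 (mod 4)` -/
  snd_emod_four : S 1 1 % 4 = 0 ∨ S 1 1 % 4 = 1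
  /-- `det S_Δ ≡ 0 (mod 4)` -/
  four_dvd_det : (4 : ℤ) ∣ S.det

/-- Remark 14's conditions are decidable (used to evaluate the table). [cite: Runge1999EndomorphismRingsAbelianSurfaces, Remark 14 (p. 299)] -/
instance (S : M₂ℤ) : Decidable (IsDiscMatrix S) :=
  decidable_of_iff (S 1 0 = S 0 1 ∧ (S 0 0 % 4 = 0 ∨ S 0 0 % 4 = 1) ∧ (S 1 1 % 4 = 0 ∨ S 1 1 % 4 = 1) ∧
      (4 : ℤ) ∣ S.det)
    ⟨fun h ↦ ⟨h.1, h.2.1, h.2.2.1, h.2.2.2⟩, fun h ↦ ⟨h.1, h.2, h.3, h.4⟩⟩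

/-- `det S = Δ₁Δ₂ − Δ²` for a symmetric `S`. [cite: Runge1999EndomorphismRingsAbelianSurfaces, §6 Thm. 7 (p. 295)] -/
theorem det_eq_of_symm {S : M₂ℤ} (hS : S 1 0 = S 0 1) : S.det = S 0 0 * S 1 1 - S 0 1 ^ 2 := by
  rw [Matrix.det_fin_two, hS]; ring

/-- A square is `≡ 0 (mod 4)` iff the number is even, `≡ 1 (mod 4)` iff it is odd (squares mod 4). [folklore] -/
private theorem sq_emod_four (b : ℤ) : (b ^ 2 % 4 = 0 ∧ 2 ∣ b) ∨ (b ^ 2 % 4 = 1 ∧ ¬ 2 ∣ b) := by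
  rcases Int.even_or_odd b with ⟨r, hr⟩ | ⟨r, hr⟩
  · left
    refine ⟨?_, ⟨r, by rw [hr]; ring⟩⟩
    have e : b ^ 2 = 4 * (r * r) := by rw [hr]; ring
    rw [e]; generalize r * r = k; omega
  · right
    refine ⟨?_, by rw [hr]; omega⟩
    have e : b ^ 2 = 4 * (r * r + r) + 1 := by rw [hr]; ring
    rw [e]; generalize r * r + r = k; omega

/-- `(ac) mod 4` from `a, c mod 4 ∈ {0, 1}`: it is `1` iff `a ≡ c ≡ 1` (arithmetic mod 4). [folklore] -/
private theorem mul_emod_four {a c : ℤ} (ha : a % 4 = 0 ∨ a % 4 = 1) (hc : c % 4 = 0 ∨ c % 4 = 1) :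
    (a * c) % 4 = if a % 4 = 1 ∧ c % 4 = 1 then 1 else 0 := by
  rw [Int.mul_emod]
  rcases ha with ha | ha <;> rcases hc with hc | hc <;> simp [ha, hc]

/-- **The parity of `Δ`:** for a discriminant matrix, `Δ` is odd iff `Δ₁ ≡ Δ₂ ≡ 1 (mod 4)` (from `Δ² ≡ Δ₁Δ₂ (mod 4)`).
[cite: Runge1999EndomorphismRingsAbelianSurfaces, Remark 14 (p. 299)] -/
theorem IsDiscMatrix.two_dvd_iff {S : M₂ℤ} (h : IsDiscMatrix S) :
    (2 : ℤ) ∣ S 0 1 ↔ ¬ (S 0 0 % 4 = 1 ∧ S 1 1 % 4 = 1) := by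
  have hdet := h.four_dvd_det
  rw [det_eq_of_symm h.symm] at hdet
  have hprod := mul_emod_four h.fst_emod_four h.snd_emod_four
  have hmod : (S 0 0 * S 1 1) % 4 = S 0 1 ^ 2 % 4 :=
    ((Int.modEq_iff_dvd.2 hdet : Int.ModEq 4 (S 0 1 ^ 2) (S 0 0 * S 1 1))).symm
  rcases sq_emod_four (S 0 1) with ⟨h0, heven⟩ | ⟨h1, hodd⟩
  · rw [hmod, h0] at hprod
    refine ⟨fun _ hc ↦ ?_, fun _ ↦ heven⟩
    rw [if_pos hc] at hprod; exact zero_ne_one hprod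
  · rw [hmod, h1] at hprod
    refine ⟨fun h2 ↦ absurd h2 hodd, fun hc ↦ ?_⟩
    by_cases hc' : S 0 0 % 4 = 1 ∧ S 1 1 % 4 = 1
    · exact absurd hc' hc
    · rw [if_neg hc'] at hprod; exact absurd hprod one_ne_zero

/-- The form modulo `4` along a residue decomposition `x = 2m + r`, `y = 2n + s`:
`S[x, y] = 4K + (Δ₁r² + 2Δrs + Δ₂s²)` (completing residues). [folklore] -/
private theorem discBinForm_decomp (S : M₂ℤ) (m n r s : ℤ) :
    discBinForm S (2 * m + r) (2 * n + s) =
      4 * (S 0 0 * (m ^ 2 + m * r) + S 0 1 * (2 * m * n + m * s + n * r) + S 1 1 * (n ^ 2 + n * s)) +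
        (S 0 0 * r ^ 2 + 2 * S 0 1 * r * s + S 1 1 * s ^ 2) := by
  simp only [discBinForm]; ring

/-- **Every value of the form of a discriminant matrix is `≡ 0` or `1 (mod 4)`** (for `S = S_Δ(q, q′)`: `Δ(xq + yq′)`
is again an invariant, B–W "always `≡ 0` or `1 mod 4`"). [cite: Runge1999EndomorphismRingsAbelianSurfaces, Remark 14 (p. 299)] -/
theorem IsDiscMatrix.discBinForm_emod_four {S : M₂ℤ} (h : IsDiscMatrix S) (x y : ℤ) :
    discBinForm S x y % 4 = 0 ∨ discBinForm S x y % 4 = 1 := by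
  have ha := h.fst_emod_four
  have hc := h.snd_emod_four
  have hpar := h.two_dvd_iff
  obtain ⟨m, r, hx, hr⟩ : ∃ m r, x = 2 * m + r ∧ (r = 0 ∨ r = 1) := ⟨x / 2, x % 2, by omega, by omega⟩
  obtain ⟨n, s, hy, hs⟩ : ∃ n s, y = 2 * n + s ∧ (s = 0 ∨ s = 1) := ⟨y / 2, y % 2, by omega, by omega⟩
  obtain ⟨K, hK⟩ : ∃ K, discBinForm S x y = 4 * K + (S 0 0 * r ^ 2 + 2 * S 0 1 * r * s + S 1 1 * s ^ 2) :=
    ⟨_, by rw [hx, hy]; exact discBinForm_decomp S m n r s⟩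
  rw [hK]
  rcases hr with rfl | rfl <;> rcases hs with rfl | rfl
  · have e : S 0 0 * (0 : ℤ) ^ 2 + 2 * S 0 1 * 0 * 0 + S 1 1 * (0 : ℤ) ^ 2 = 0 := by ring
    rw [e]; omega
  · have e : S 0 0 * (0 : ℤ) ^ 2 + 2 * S 0 1 * 0 * 1 + S 1 1 * (1 : ℤ) ^ 2 = S 1 1 := by ring
    rw [e]; omega
  · have e : S 0 0 * (1 : ℤ) ^ 2 + 2 * S 0 1 * 1 * 0 + S 1 1 * (0 : ℤ) ^ 2 = S 0 0 := by ring
    rw [e]; omega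
  · -- `r = s = 1`: the value is `Δ₁ + 2Δ + Δ₂`
    have e : S 0 0 * (1 : ℤ) ^ 2 + 2 * S 0 1 * 1 * 1 + S 1 1 * (1 : ℤ) ^ 2 = S 0 0 + 2 * S 0 1 + S 1 1 := by
      ring
    rw [e]
    by_cases h11 : S 0 0 % 4 = 1 ∧ S 1 1 % 4 = 1
    · have hodd : ¬ (2 : ℤ) ∣ S 0 1 := fun h2 ↦ (hpar.1 h2) h11
      left; omega
    · have heven : (2 : ℤ) ∣ S 0 1 := hpar.2 h11
      obtain ⟨k, hk⟩ := heven
      rw [hk]; omega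

/-- **Characterisation: `S` is a discriminant matrix iff it is symmetric and all values of its form are `≡ 0, 1 (4)`.**
[cite: Runge1999EndomorphismRingsAbelianSurfaces, Remark 14 (p. 299)] -/
theorem isDiscMatrix_iff_forall_emod_four (S : M₂ℤ) :
    IsDiscMatrix S ↔ S 1 0 = S 0 1 ∧ ∀ x y : ℤ, discBinForm S x y % 4 = 0 ∨ discBinForm S x y % 4 = 1 := by
  constructor
  · exact fun h ↦ ⟨h.symm, h.discBinForm_emod_four⟩
  · rintro ⟨hS, h⟩
    have ha := h 1 0
    have hc := h 0 1
    have h11 := h 1 1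
    rw [discBinForm_one_zero] at ha
    rw [discBinForm_zero_one] at hc
    rw [discBinForm_one_one] at h11
    refine ⟨hS, ha, hc, ?_⟩
    rw [det_eq_of_symm hS]
    -- `Δ² ≡ Δ₁Δ₂ (mod 4)` from the three residues
    have hprod := mul_emod_four ha hc
    rcases sq_emod_four (S 0 1) with ⟨h0, ⟨k, hk⟩⟩ | ⟨h1, hodd⟩
    · -- `Δ` even: `Δ₁ + Δ₂ ≡ 0,1 (4)` forces not both `≡ 1`
      have hne : ¬ (S 0 0 % 4 = 1 ∧ S 1 1 % 4 = 1) := by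
        rintro ⟨h1', h2'⟩; rw [hk] at h11; omega
      rw [if_neg hne] at hprod
      omega
    · -- `Δ` odd: `Δ₁ + 2Δ + Δ₂ ≡ Δ₁ + Δ₂ + 2`, forcing `Δ₁ ≡ Δ₂ ≡ 1`
      have hb : S 0 1 % 2 = 1 := by omega
      have hboth : S 0 0 % 4 = 1 ∧ S 1 1 % 4 = 1 := by omega
      rw [if_pos hboth] at hprod
      omega

/-- **`IsDiscMatrix` is a class invariant.** [cite: Runge1999EndomorphismRingsAbelianSurfaces, Remark 14 (p. 299: "… mod `Gl(2, ℤ)`")] -/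
theorem IsDiscMatrix.discBaseChange {S : M₂ℤ} (h : IsDiscMatrix S) (g : M₂ℤ) : IsDiscMatrix (discBaseChange g S) := by
  rw [isDiscMatrix_iff_forall_emod_four]
  refine ⟨discBaseChange_symm h.symm g, fun x y ↦ ?_⟩
  rw [discBinForm_discBaseChange h.symm]
  exact h.discBinForm_emod_four _ _

/-- `IsDiscMatrix` along `IsGLEquiv`. [cite: Runge1999EndomorphismRingsAbelianSurfaces, Remark 14 (p. 299)] -/
theorem IsGLEquiv.isDiscMatrix {S S' : M₂ℤ} (h : IsGLEquiv S S') (hS : IsDiscMatrix S) : IsDiscMatrix S' := by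
  obtain ⟨g, -, rfl⟩ := h; exact hS.discBaseChange g

/-- **The content `g.c.d.(Δ₁, Δ, Δ₂)` of a discriminant matrix.** [cite: Runge1999EndomorphismRingsAbelianSurfaces, §6 p. 297 ("primitive if `g.c.d.(Δ(α), Δ(α,β), Δ(β)) = 1`")] -/
def discContent (S : M₂ℤ) : ℕ := Int.gcd (Int.gcd (S 0 0) (S 0 1)) (S 1 1)

/-- **Primitive discriminant matrices: `g.c.d.(Δ₁, Δ, Δ₂) = 1`.** [cite: Runge1999EndomorphismRingsAbelianSurfaces, §1 p. 284 and §6 p. 297] -/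
def IsPrimitiveDisc (S : M₂ℤ) : Prop := discContent S = 1

/-- Primitivity is decidable (used to evaluate `h_QCM,primitive`). [cite: Runge1999EndomorphismRingsAbelianSurfaces, Remark 14 (p. 299)] -/
instance (S : M₂ℤ) : Decidable (IsPrimitiveDisc S) := inferInstanceAs (Decidable (discContent S = 1))

/-- The content divides the three entries. [cite: Runge1999EndomorphismRingsAbelianSurfaces, §6 p. 297] -/
theorem discContent_dvd (S : M₂ℤ) :
    (discContent S : ℤ) ∣ S 0 0 ∧ (discContent S : ℤ) ∣ S 0 1 ∧ (discContent S : ℤ) ∣ S 1 1 := by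
  refine ⟨?_, ?_, Int.gcd_dvd_right _ _⟩
  · exact (Int.gcd_dvd_left _ _).trans (Int.gcd_dvd_left _ _)
  · exact (Int.gcd_dvd_left _ _).trans (Int.gcd_dvd_right _ _)

/-- A common divisor of the entries divides the content. [cite: Runge1999EndomorphismRingsAbelianSurfaces, §6 p. 297] -/
theorem dvd_discContent {S : M₂ℤ} {e : ℤ} (h0 : e ∣ S 0 0) (h1 : e ∣ S 0 1) (h2 : e ∣ S 1 1) :
    e ∣ (discContent S : ℤ) :=
  Int.dvd_coe_gcd (Int.dvd_coe_gcd h0 h1) h2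

/-- The content of `S` divides every entry of `S[g]`. [cite: Runge1999EndomorphismRingsAbelianSurfaces, §1 p. 284] -/
theorem discContent_dvd_discBaseChange {S : M₂ℤ} (hS : S 1 0 = S 0 1) (g : M₂ℤ) :
    (discContent S : ℤ) ∣ (discContent (discBaseChange g S) : ℤ) := by
  obtain ⟨h0, h1, h2⟩ := discContent_dvd S
  have hM := discBaseChange_apply_of_symm hS g
  refine dvd_discContent ?_ ?_ ?_
  · rw [hM]; simp only [Matrix.of_apply, Matrix.cons_val', Matrix.cons_val_zero, Matrix.empty_val',
      Matrix.cons_val_fin_one]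
    exact dvd_add (dvd_add (dvd_mul_of_dvd_left h0 _) (dvd_mul_of_dvd_left (dvd_mul_of_dvd_left
      (dvd_mul_of_dvd_right h1 _) _) _)) (dvd_mul_of_dvd_left h2 _)
  · rw [hM]; simp only [Matrix.of_apply, Matrix.cons_val', Matrix.cons_val_zero, Matrix.cons_val_one,
      Matrix.empty_val', Matrix.cons_val_fin_one]
    exact dvd_add (dvd_add (dvd_mul_of_dvd_left (dvd_mul_of_dvd_left h0 _) _) (dvd_mul_of_dvd_left h1 _))
      (dvd_mul_of_dvd_left (dvd_mul_of_dvd_left h2 _) _)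
  · rw [hM]; simp only [Matrix.of_apply, Matrix.cons_val', Matrix.cons_val_one, Matrix.empty_val',
      Matrix.cons_val_fin_one]
    exact dvd_add (dvd_add (dvd_mul_of_dvd_left h0 _) (dvd_mul_of_dvd_left (dvd_mul_of_dvd_left
      (dvd_mul_of_dvd_right h1 _) _) _)) (dvd_mul_of_dvd_left h2 _)

/-- **The content — hence primitivity — is a class invariant.** [cite: Runge1999EndomorphismRingsAbelianSurfaces, Remark 14 (p. 299: "the subset of primitive classes")] -/
theorem IsGLEquiv.discContent_eq {S S' : M₂ℤ} (h : IsGLEquiv S S') (hS : S 1 0 = S 0 1) :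
    discContent S' = discContent S := by
  have h1 : (discContent S : ℤ) ∣ discContent S' := by
    obtain ⟨g, -, rfl⟩ := h; exact discContent_dvd_discBaseChange hS g
  have h2 : (discContent S' : ℤ) ∣ discContent S := by
    obtain ⟨g, -, rfl⟩ := h.symm; exact discContent_dvd_discBaseChange (h.symm_apply hS) g
  exact Nat.dvd_antisymm (Int.natCast_dvd_natCast.1 h2) (Int.natCast_dvd_natCast.1 h1)

/-- Primitivity along `IsGLEquiv`. [cite: Runge1999EndomorphismRingsAbelianSurfaces, Remark 14 (p. 299)] -/
theorem IsGLEquiv.isPrimitiveDisc_iff {S S' : M₂ℤ} (h : IsGLEquiv S S') (hS : S 1 0 = S 0 1) :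
    IsPrimitiveDisc S' ↔ IsPrimitiveDisc S := by
  rw [IsPrimitiveDisc, IsPrimitiveDisc, h.discContent_eq hS]

/-- **Simple classes: the form represents no non-zero square** ("A class is simple if it does not represent non-zero
squares"; on `H_q ∩ H_{q′}` with `ρ(X_Z) = 3` this is `X_Z` simple, A4-66 FILE 5 `isSimple_iff_forall_discForm_ne_sq`).
[cite: Runge1999EndomorphismRingsAbelianSurfaces, Remark 14 (p. 299) and §6 p. 296] -/
def IsSimpleDisc (S : M₂ℤ) : Prop := ∀ x y m : ℤ, m ≠ 0 → discBinForm S x y ≠ m ^ 2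

/-- **Simplicity is a class invariant.** [cite: Runge1999EndomorphismRingsAbelianSurfaces, Remark 14 (p. 299: "the subset of simple classes")] -/
theorem IsGLEquiv.isSimpleDisc_iff {S S' : M₂ℤ} (h : IsGLEquiv S S') (hS : S 1 0 = S 0 1) :
    IsSimpleDisc S' ↔ IsSimpleDisc S := by
  constructor
  · intro h' x y m hm hxy
    obtain ⟨x', y', e⟩ := h.exists_discBinForm_eq' hS x y
    exact h' x' y' m hm (e.trans hxy)
  · intro h' x y m hm hxy
    obtain ⟨x', y', e⟩ := h.exists_discBinForm_eq hS x y
    exact h' x' y' m hm (e.trans hxy)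

/-- A represented non-zero square refutes simplicity. [cite: Runge1999EndomorphismRingsAbelianSurfaces, Remark 14 (p. 299)] -/
theorem not_isSimpleDisc_of_eq_sq {S : M₂ℤ} {x y m : ℤ} (hm : m ≠ 0) (h : discBinForm S x y = m ^ 2) :
    ¬ IsSimpleDisc S := fun hs ↦ hs x y m hm h

end Admissible

/-! ## §3 Runge's reduced matrices `0 ≤ 2Δ ≤ Δ₁ ≤ Δ₂`; `3Δ₁² ≤ 16d`; every class contains one -/

section Reduced

/-- **Runge's reduced discriminant matrices: `0 ≤ 2Δ ≤ Δ₁ ≤ Δ₂`** ("the reduced `S_Δ`, which we define by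
`0 ≤ Δ ≤ Δ₁/2 ≤ Δ₁ ≤ Δ₂`"; see the OCR caveat in the module docstring — this reading reproduces the printed table).
[cite: Runge1999EndomorphismRingsAbelianSurfaces, Remark 14 (p. 299)] -/
def IsRungeReduced (S : M₂ℤ) : Prop := 0 ≤ S 0 1 ∧ 2 * S 0 1 ≤ S 0 0 ∧ S 0 0 ≤ S 1 1

/-- Reducedness is decidable (used to evaluate the table). [cite: Runge1999EndomorphismRingsAbelianSurfaces, Remark 14 (p. 299)] -/
instance (S : M₂ℤ) : Decidable (IsRungeReduced S) :=
  inferInstanceAs (Decidable (0 ≤ S 0 1 ∧ 2 * S 0 1 ≤ S 0 0 ∧ S 0 0 ≤ S 1 1))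

/-- Unfolding of `IsRungeReduced`. [cite: Runge1999EndomorphismRingsAbelianSurfaces, Remark 14 (p. 299)] -/
theorem isRungeReduced_iff (S : M₂ℤ) : IsRungeReduced S ↔ 0 ≤ S 0 1 ∧ 2 * S 0 1 ≤ S 0 0 ∧ S 0 0 ≤ S 1 1 := Iff.rfl

/-- A reduced symmetric matrix with `Δ₁ > 0` is positive definite: `det S = Δ₁Δ₂ − Δ² ≥ ¾Δ₁² > 0`.
[cite: Runge1999EndomorphismRingsAbelianSurfaces, Remark 14 (p. 299)] -/
theorem det_pos_of_isRungeReduced {S : M₂ℤ} (hS : S 1 0 = S 0 1) (hr : IsRungeReduced S) (ha : 0 < S 0 0) :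
    0 < S.det := by
  obtain ⟨h0, h1, h2⟩ := hr
  rw [det_eq_of_symm hS]
  nlinarith

/-- **Finiteness: `3Δ₁² ≤ 4 det S_Δ` for a reduced matrix — Runge's "`3Δ₁² ≤ 16d`" for `det S_Δ = 4d`.**
[cite: Runge1999EndomorphismRingsAbelianSurfaces, Remark 14 (p. 299: "There are only finitely many such reduced `S_Δ`, which follows from `3Δ₁² ≤ 16d`")] -/
theorem three_mul_sq_le_four_mul_det {S : M₂ℤ} (hS : S 1 0 = S 0 1) (hr : IsRungeReduced S) :
    3 * S 0 0 ^ 2 ≤ 4 * S.det := by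
  obtain ⟨h0, h1, h2⟩ := hr
  rw [det_eq_of_symm hS]
  nlinarith

/-- `3Δ₁² ≤ 16d` verbatim, for `det S_Δ = 4d`. [cite: Runge1999EndomorphismRingsAbelianSurfaces, Remark 14 (p. 299)] -/
theorem three_mul_sq_le_of_det_eq {S : M₂ℤ} {d : ℤ} (hS : S 1 0 = S 0 1) (hr : IsRungeReduced S) (hd : S.det = 4 * d) :
    3 * S 0 0 ^ 2 ≤ 16 * d := by
  have := three_mul_sq_le_four_mul_det hS hr; rw [hd] at this; linarith

/-- In a reduced matrix `2Δ ≤ Δ₁` and `Δ₂ = (Δ² + det S)/Δ₁` ("`Δ₂ = (Δ² + 4d)/Δ₁`").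
[cite: Runge1999EndomorphismRingsAbelianSurfaces, Remark 14 (p. 299)] -/
theorem snd_eq_of_symm {S : M₂ℤ} (hS : S 1 0 = S 0 1) (ha : S 0 0 ≠ 0) :
    S 1 1 = (S 0 1 ^ 2 + S.det) / S 0 0 := by
  rw [det_eq_of_symm hS, show S 0 1 ^ 2 + (S 0 0 * S 1 1 - S 0 1 ^ 2) = S 0 0 * S 1 1 by ring,
    Int.mul_ediv_cancel_left _ ha]

/-- The `T`-step of the descent: `g = (1 0; m 1)` replaces `Δ` by `Δ + mΔ₁` and keeps `Δ₁`.
(Gauss reduction, cf. Cox §2.A Thm. 2.8). [folklore] -/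
private theorem discBaseChange_T {S : M₂ℤ} (hS : S 1 0 = S 0 1) (m : ℤ) :
    discBaseChange !![1, 0; m, 1] S 0 0 = S 0 0 ∧ discBaseChange !![1, 0; m, 1] S 0 1 = S 0 1 + m * S 0 0 := by
  rw [discBaseChange_apply_of_symm hS]
  refine ⟨by simp, ?_⟩
  simp only [Matrix.of_apply, Matrix.cons_val', Matrix.cons_val_zero, Matrix.cons_val_one, Matrix.empty_val',
    Matrix.cons_val_fin_one]
  ring

/-- The `S`-step: `g = (0 1; 1 0)` swaps `Δ₁, Δ₂` and keeps `Δ` (Gauss reduction, cf. Cox §2.A Thm. 2.8). [folklore] -/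
private theorem discBaseChange_swap {S : M₂ℤ} (hS : S 1 0 = S 0 1) :
    discBaseChange !![0, 1; 1, 0] S 0 0 = S 1 1 ∧ discBaseChange !![0, 1; 1, 0] S 0 1 = S 0 1 ∧
      discBaseChange !![0, 1; 1, 0] S 1 1 = S 0 0 := by
  rw [discBaseChange_apply_of_symm hS]; refine ⟨?_, ?_, ?_⟩ <;> simp

/-- The sign flip: `g = (1 0; 0 −1)` replaces `Δ` by `−Δ` (this is where `Gl₂`, not `SL₂`, is used).
(improper equivalence). [folklore] -/
private theorem discBaseChange_flip {S : M₂ℤ} (hS : S 1 0 = S 0 1) :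
    discBaseChange !![1, 0; 0, -1] S 0 0 = S 0 0 ∧ discBaseChange !![1, 0; 0, -1] S 0 1 = -S 0 1 ∧
      discBaseChange !![1, 0; 0, -1] S 1 1 = S 1 1 := by
  rw [discBaseChange_apply_of_symm hS]; refine ⟨?_, ?_, ?_⟩ <;> simp

/-- `det S > 0` and `Δ₁ > 0` force `Δ₂ > 0` (symmetric `S`) (positive definite 2×2). [folklore] -/
private theorem snd_pos {S : M₂ℤ} (hS : S 1 0 = S 0 1) (ha : 0 < S 0 0) (hdet : 0 < S.det) : 0 < S 1 1 := by
  rw [det_eq_of_symm hS] at hdet; nlinarith [sq_nonneg (S 0 1)]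

/-- Descent, the Cox-type normal form: every positive definite symmetric `S` is `Gl₂(ℤ)`-equivalent to a symmetric
`S′` with `2|Δ′| ≤ Δ₁′ ≤ Δ₂′` and `Δ₁′ > 0` (Gauss–Lagrange reduction, cf. Cox §2.A Thm. 2.8). [folklore] -/
private theorem exists_isGLEquiv_abs_le :
    ∀ (n : ℕ) (S : M₂ℤ), S 1 0 = S 0 1 → 0 < S 0 0 → 0 < S.det → S 0 0 + |S 0 1| ≤ n →
      ∃ S' : M₂ℤ, IsGLEquiv S S' ∧ S' 1 0 = S' 0 1 ∧ 0 < S' 0 0 ∧ 2 * |S' 0 1| ≤ S' 0 0 ∧ S' 0 0 ≤ S' 1 1 := by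
  intro n
  induction n with
  | zero =>
    intro S _ ha _ hn
    exfalso; have := abs_nonneg (S 0 1); push_cast at hn; linarith
  | succ n ih =>
    intro S hS ha hdet hn
    push_cast at hn
    by_cases h1 : S 0 0 < 2 * |S 0 1|
    · -- `T`-step: bring `2Δ` into `(−Δ₁, Δ₁]` by `Δ ↦ Δ + mΔ₁`, `m = ⌊(Δ₁ − 2Δ)/(2Δ₁)⌋`
      have h2a : 0 < 2 * S 0 0 := by linarith
      have hdiv := Int.emod_add_mul_ediv (S 0 0 - 2 * S 0 1) (2 * S 0 0)
      have hmod0 := Int.emod_nonneg (S 0 0 - 2 * S 0 1) h2a.ne'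
      have hmod1 := Int.emod_lt_of_pos (S 0 0 - 2 * S 0 1) h2a
      obtain ⟨e0, e1⟩ := discBaseChange_T hS ((S 0 0 - 2 * S 0 1) / (2 * S 0 0))
      have hS₁symm := discBaseChange_symm hS !![1, 0; (S 0 0 - 2 * S 0 1) / (2 * S 0 0), 1]
      have hb' : 2 * |discBaseChange !![1, 0; (S 0 0 - 2 * S 0 1) / (2 * S 0 0), 1] S 0 1| ≤ S 0 0 := by
        rw [e1]
        have h2z : |2 * (S 0 1 + (S 0 0 - 2 * S 0 1) / (2 * S 0 0) * S 0 0)| ≤ S 0 0 :=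
          abs_le.2 ⟨by linarith, by linarith⟩
        rwa [abs_mul, abs_two] at h2z
      have hlt : |discBaseChange !![1, 0; (S 0 0 - 2 * S 0 1) / (2 * S 0 0), 1] S 0 1| < |S 0 1| := by
        linarith
      have hdet₁ : 0 < (discBaseChange !![1, 0; (S 0 0 - 2 * S 0 1) / (2 * S 0 0), 1] S).det := by
        rw [det_discBaseChange]; simp [Matrix.det_fin_two_of]; exact hdet
      have hequiv : IsGLEquiv S (discBaseChange !![1, 0; (S 0 0 - 2 * S 0 1) / (2 * S 0 0), 1] S) :=
        ⟨_, by simp [Matrix.det_fin_two_of], rfl⟩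
      obtain ⟨S', h', hsymm', ha', hb'', hc'⟩ :=
        ih _ hS₁symm (by rw [e0]; exact ha) hdet₁ (by rw [e0]; linarith)
      exact ⟨S', hequiv.trans h', hsymm', ha', hb'', hc'⟩
    · push Not at h1
      by_cases h2 : S 0 0 ≤ S 1 1
      · exact ⟨S, IsGLEquiv.refl S, hS, ha, h1, h2⟩
      · -- swap step: `Δ₁ > Δ₂`
        push Not at h2
        have hc : 0 < S 1 1 := snd_pos hS ha hdet
        obtain ⟨e0, e1, e2⟩ := discBaseChange_swap hS
        have hS₁symm := discBaseChange_symm hS !![0, 1; 1, 0]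
        have hdet₁ : 0 < (discBaseChange !![0, 1; 1, 0] S).det := by
          rw [det_discBaseChange]; simp [Matrix.det_fin_two_of]; exact hdet
        have hequiv : IsGLEquiv S (discBaseChange !![0, 1; 1, 0] S) := ⟨_, by simp [Matrix.det_fin_two_of], rfl⟩
        obtain ⟨S', h', hsymm', ha', hb'', hc'⟩ :=
          ih _ hS₁symm (by rw [e0]; exact hc) hdet₁ (by rw [e0, e1]; linarith)
        exact ⟨S', hequiv.trans h', hsymm', ha', hb'', hc'⟩

/-- **"Using the action of `Gl(2, ℤ)`, any `S_Δ` is similar to a reduced matrix"** — for EVERY positive definite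
symmetric integer `2 × 2` matrix (`Δ₁ > 0`, `det > 0`); the reduced matrix is again symmetric with `Δ₁ > 0`.
[cite: Runge1999EndomorphismRingsAbelianSurfaces, Remark 14 (p. 299)] -/
theorem exists_isGLEquiv_isRungeReduced {S : M₂ℤ} (hS : S 1 0 = S 0 1) (ha : 0 < S 0 0) (hdet : 0 < S.det) :
    ∃ S' : M₂ℤ, IsGLEquiv S S' ∧ S' 1 0 = S' 0 1 ∧ 0 < S' 0 0 ∧ IsRungeReduced S' := by
  obtain ⟨S₁, h₁, hsymm, ha₁, hb₁, hc₁⟩ :=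
    exists_isGLEquiv_abs_le (S 0 0 + |S 0 1|).toNat S hS ha hdet (Int.self_le_toNat _)
  by_cases hb : 0 ≤ S₁ 0 1
  · exact ⟨S₁, h₁, hsymm, ha₁, hb, by rw [abs_of_nonneg hb] at hb₁; exact hb₁, hc₁⟩
  · push Not at hb
    obtain ⟨e0, e1, e2⟩ := discBaseChange_flip hsymm
    refine ⟨discBaseChange !![1, 0; 0, -1] S₁, h₁.trans ⟨_, by simp [Matrix.det_fin_two_of], rfl⟩,
      discBaseChange_symm hsymm _, by rw [e0]; exact ha₁, ?_, ?_, ?_⟩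
    · rw [e1]; linarith
    · rw [e1, e0]; rw [abs_of_neg hb] at hb₁; linarith
    · rw [e0, e2]; exact hc₁

end Reduced

/-! ## §4 Uniqueness of the reduced representative: `Δ₁ = min S[v]`, `Δ₂ = min {S[x, y] : y ≠ 0}` -/

section Unique

variable {S : M₂ℤ}

/-- `u² − uv + v² ≥ 1` for non-negative integers not both zero. [folklore] -/
private theorem one_le_sq_sub (u v : ℤ) (hu : 0 ≤ u) (hv : 0 ≤ v) (h : ¬ (u = 0 ∧ v = 0)) :
    1 ≤ u ^ 2 - u * v + v ^ 2 := by
  by_cases hu0 : u = 0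
  · subst hu0; have : v ≠ 0 := fun hv0 ↦ h ⟨rfl, hv0⟩
    nlinarith [sq_pos_of_ne_zero this]
  · by_cases hv0 : v = 0
    · subst hv0; nlinarith [sq_pos_of_ne_zero hu0]
    · have hu1 : 1 ≤ u := by omega
      have hv1 : 1 ≤ v := by omega
      nlinarith [sq_nonneg (u - v)]

/-- **`Δ₁` is the minimum of a reduced form: `S[x, y] ≥ Δ₁` for `(x, y) ≠ (0, 0)`** (Cox's argument for the uniqueness
half of Thm. 2.8, run for `Gl(2, ℤ)`-reduced matrices). [cite: Cox2013, §2.A proof of Thm. 2.8] -/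
theorem le_discBinForm_of_isRungeReduced (hr : IsRungeReduced S) {x y : ℤ} (hxy : ¬ (x = 0 ∧ y = 0)) :
    S 0 0 ≤ discBinForm S x y := by
  obtain ⟨h0, h1, h2⟩ := hr
  rw [discBinForm]
  set u := |x| with hu
  set v := |y| with hv
  have hu0 : 0 ≤ u := abs_nonneg x
  have hv0 : 0 ≤ v := abs_nonneg y
  have hx2 : x ^ 2 = u ^ 2 := (sq_abs x).symm
  have hy2 : y ^ 2 = v ^ 2 := (sq_abs y).symm
  have hxy' : |x * y| = u * v := abs_mul x y
  have hcross : -(S 0 0 * (u * v)) ≤ 2 * S 0 1 * x * y := by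
    have h3 : |2 * S 0 1 * x * y| ≤ S 0 0 * (u * v) := by
      rw [show 2 * S 0 1 * x * y = (2 * S 0 1) * (x * y) by ring, abs_mul, hxy',
        abs_of_nonneg (by linarith : (0 : ℤ) ≤ 2 * S 0 1)]
      exact mul_le_mul_of_nonneg_right h1 (mul_nonneg hu0 hv0)
    have := neg_abs_le (2 * S 0 1 * x * y); linarith
  have huv : ¬ (u = 0 ∧ v = 0) := by
    rintro ⟨hu', hv'⟩; exact hxy ⟨abs_eq_zero.1 hu', abs_eq_zero.1 hv'⟩
  have hone := one_le_sq_sub u v hu0 hv0 huv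
  rw [hx2, hy2]
  nlinarith [mul_nonneg hu0 hv0, sq_nonneg v]

/-- **`Δ₂ ≤ S[x, y]` whenever `y ≠ 0`** (the second successive minimum of a reduced form; Cox's argument for the
uniqueness half of Thm. 2.8). [cite: Cox2013, §2.A proof of Thm. 2.8] -/
theorem snd_le_discBinForm_of_isRungeReduced (hr : IsRungeReduced S) {x y : ℤ} (hy : y ≠ 0) :
    S 1 1 ≤ discBinForm S x y := by
  obtain ⟨h0, h1, h2⟩ := hr
  rw [discBinForm]
  set u := |x| with hu
  set v := |y| with hv
  have hu0 : 0 ≤ u := abs_nonneg x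
  have hv1 : 1 ≤ v := by
    have := abs_pos.2 hy; omega
  have hx2 : x ^ 2 = u ^ 2 := (sq_abs x).symm
  have hy2 : y ^ 2 = v ^ 2 := (sq_abs y).symm
  have hxy' : |x * y| = u * v := abs_mul x y
  have hcross : -(S 0 0 * (u * v)) ≤ 2 * S 0 1 * x * y := by
    have h3 : |2 * S 0 1 * x * y| ≤ S 0 0 * (u * v) := by
      rw [show 2 * S 0 1 * x * y = (2 * S 0 1) * (x * y) by ring, abs_mul, hxy',
        abs_of_nonneg (by linarith : (0 : ℤ) ≤ 2 * S 0 1)]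
      exact mul_le_mul_of_nonneg_right h1 (mul_nonneg hu0 (by linarith))
    have := neg_abs_le (2 * S 0 1 * x * y); linarith
  rw [hx2, hy2]
  -- `S[x,y] ≥ Δ₁u² − Δ₁uv + Δ₂v²`
  have hlow : S 0 0 * u ^ 2 - S 0 0 * (u * v) + S 1 1 * v ^ 2 ≤ S 0 0 * u ^ 2 + 2 * S 0 1 * x * y + S 1 1 * v ^ 2 := by
    linarith
  refine le_trans ?_ hlow
  have hc0 : 0 ≤ S 1 1 := by linarith
  have hB : S 1 1 ≤ S 1 1 * v ^ 2 := by nlinarith [mul_nonneg hc0 (show 0 ≤ v ^ 2 - 1 by nlinarith)]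
  by_cases huv : v ≤ u
  · -- `Δ₁u(u − v) ≥ 0` and `Δ₂v² ≥ Δ₂`
    have ha0 : 0 ≤ S 0 0 := by linarith
    have hA : 0 ≤ S 0 0 * u * (u - v) := mul_nonneg (mul_nonneg ha0 hu0) (sub_nonneg.2 huv)
    have e : S 0 0 * u ^ 2 - S 0 0 * (u * v) = S 0 0 * u * (u - v) := by ring
    linarith
  · push Not at huv
    -- `Δ₁(u² − uv + v²) + (Δ₂ − Δ₁)v² ≥ Δ₁ + (Δ₂ − Δ₁)`
    have hone : 1 ≤ u ^ 2 - u * v + v ^ 2 := by nlinarith [sq_nonneg (u - v)]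
    have ha0 : 0 ≤ S 0 0 := by linarith
    nlinarith [mul_le_mul_of_nonneg_left hone ha0, mul_le_mul_of_nonneg_left (show 1 ≤ v ^ 2 by nlinarith)
      (sub_nonneg.2 h2)]

/-- One direction of the comparison: for reduced `S`, `S′ = S[g]` reduced and `det g = ±1`:
`Δ₁ ≤ Δ₁′` and `Δ₂ ≤ Δ₂′` (Lagrange; cf. Cox §2.A Thm. 2.8). [folklore] -/
private theorem le_of_discBaseChange (hS : S 1 0 = S 0 1) (hr : IsRungeReduced S) {g : M₂ℤ} (hg : IsUnit g.det)
    (hr' : IsRungeReduced (discBaseChange g S)) :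
    S 0 0 ≤ discBaseChange g S 0 0 ∧ S 1 1 ≤ discBaseChange g S 1 1 := by
  have hdet : g.det = g 0 0 * g 1 1 - g 0 1 * g 1 0 := Matrix.det_fin_two g
  have e00 := discBaseChange_zero_zero hS g
  have e11 := discBaseChange_one_one' hS g
  have hrow0 : ¬ (g 0 0 = 0 ∧ g 0 1 = 0) := by
    rintro ⟨h1, h2⟩; apply hg.ne_zero; rw [hdet, h1, h2]; ring
  have hA : S 0 0 ≤ discBaseChange g S 0 0 := by
    rw [e00]; exact le_discBinForm_of_isRungeReduced hr hrow0
  refine ⟨hA, ?_⟩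
  by_cases h11 : g 1 1 = 0
  · -- degenerate case: `g₁₁ = 0`, so `g₀₁g₁₀ = ∓1`, `Δ₂′ = Δ₁ g₁₀² = Δ₁`, and `Δ₁′ ≥ Δ₂`
    have hunit : g 0 1 * g 1 0 = 1 ∨ g 0 1 * g 1 0 = -1 := by
      rcases Int.isUnit_iff.1 hg with h | h <;> [right; left] <;> rw [hdet, h11] at h <;> linarith
    have h10sq : g 1 0 ^ 2 = 1 := by
      rcases hunit with h | h
      · have := Int.eq_one_or_neg_one_of_mul_eq_one' h; rcases this with ⟨-, h'⟩ | ⟨-, h'⟩ <;> simp [h']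
      · have := Int.eq_one_or_neg_one_of_mul_eq_neg_one' h; rcases this with ⟨-, h'⟩ | ⟨-, h'⟩ <;> simp [h']
    have h01 : g 0 1 ≠ 0 := by rintro h; rw [h, zero_mul] at hunit; simp at hunit
    have hc' : discBaseChange g S 1 1 = S 0 0 := by
      rw [e11, discBinForm, h11]; simp [h10sq]
    have ha' : S 1 1 ≤ discBaseChange g S 0 0 := by
      rw [e00]; exact snd_le_discBinForm_of_isRungeReduced hr h01
    -- `Δ₂ ≤ Δ₁′ ≤ Δ₂′`
    exact ha'.trans hr'.2.2
  · rw [e11]; exact snd_le_discBinForm_of_isRungeReduced hr h11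

/-- **UNIQUENESS of the reduced representative: two `Gl(2, ℤ)`-equivalent Runge-reduced symmetric matrices are
EQUAL** (`Δ₁ = Δ₁′` and `Δ₂ = Δ₂′` by the successive-minima inequalities in both directions, then `Δ² = Δ′²` from
`det`, and `Δ, Δ′ ≥ 0`). This is what makes counting reduced matrices a count of classes.
[cite: Runge1999EndomorphismRingsAbelianSurfaces, Remark 14 (p. 299: "The computation is done by considering the reduced `S_Δ`")] -/
theorem eq_of_isGLEquiv_of_isRungeReduced {S S' : M₂ℤ} (hS : S 1 0 = S 0 1) (hr : IsRungeReduced S)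
    (hr' : IsRungeReduced S') (h : IsGLEquiv S S') : S = S' := by
  have hS' : S' 1 0 = S' 0 1 := h.symm_apply hS
  obtain ⟨g, hg, hgS⟩ := h
  obtain ⟨g', hg', hg'S⟩ := (show IsGLEquiv S S' from ⟨g, hg, hgS⟩).symm
  have h₁ := le_of_discBaseChange hS hr hg (by rw [hgS]; exact hr')
  have h₂ := le_of_discBaseChange hS' hr' hg' (by rw [hg'S]; exact hr)
  rw [hgS] at h₁; rw [hg'S] at h₂
  have e00 : S 0 0 = S' 0 0 := le_antisymm h₁.1 h₂.1
  have e11 : S 1 1 = S' 1 1 := le_antisymm h₁.2 h₂.2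
  have hdet : S'.det = S.det := IsGLEquiv.det_eq ⟨g, hg, hgS⟩
  rw [det_eq_of_symm hS, det_eq_of_symm hS', ← e00, ← e11] at hdet
  have hsq : S 0 1 ^ 2 = S' 0 1 ^ 2 := by linarith
  have e01 : S 0 1 = S' 0 1 := (pow_left_inj₀ hr.1 hr'.1 two_ne_zero).1 hsq
  rw [eq_of_symm hS, eq_of_symm hS', e00, e01, e11]

end Unique

/-! ## §5 The enumeration of reduced discriminant matrices of determinant `4d` and the table of `h_QCM(d)` -/

section Enumeration

open Literature.NumberTheory.QuadraticFields.Quadratic (BinQF)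

/-- The symmetric matrix `(Δ₁ Δ; Δ Δ₂)` of a triple. [cite: Runge1999EndomorphismRingsAbelianSurfaces, Remark 14 (p. 299)] -/
def symMat (t : ℤ × ℤ × ℤ) : M₂ℤ := !![t.1, t.2.1; t.2.1, t.2.2]

/-- Entries of `symMat`. [cite: Runge1999EndomorphismRingsAbelianSurfaces, Remark 14 (p. 299)] -/
@[simp] theorem symMat_apply (a b c : ℤ) :
    symMat (a, b, c) 0 0 = a ∧ symMat (a, b, c) 0 1 = b ∧ symMat (a, b, c) 1 0 = b ∧ symMat (a, b, c) 1 1 = c := by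
  simp [symMat]

/-- `symMat` of the entries of a symmetric matrix is the matrix. [cite: Runge1999EndomorphismRingsAbelianSurfaces, Remark 14 (p. 299)] -/
theorem symMat_entries {S : M₂ℤ} (hS : S 1 0 = S 0 1) : symMat (S 0 0, S 0 1, S 1 1) = S := by
  rw [symMat]; exact (eq_of_symm hS).symm

/-- **Runge's reduced admissible triples of determinant `4d`**: `Δ₁ > 0`, `0 ≤ 2Δ ≤ Δ₁ ≤ Δ₂`, `Δ₁Δ₂ − Δ² = 4d`,
`Δ₁, Δ₂ ≡ 0, 1 (4)` (a decidable predicate on `ℤ × ℤ × ℤ`). [cite: Runge1999EndomorphismRingsAbelianSurfaces, Remark 14 (p. 299)] -/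
def IsQCMReduced (d : ℕ) (t : ℤ × ℤ × ℤ) : Prop :=
  0 < t.1 ∧ 0 ≤ t.2.1 ∧ 2 * t.2.1 ≤ t.1 ∧ t.1 ≤ t.2.2 ∧ t.1 * t.2.2 - t.2.1 ^ 2 = 4 * d ∧
    (t.1 % 4 = 0 ∨ t.1 % 4 = 1) ∧ (t.2.2 % 4 = 0 ∨ t.2.2 % 4 = 1)

/-- `IsQCMReduced` is decidable (used to evaluate the table). [cite: Runge1999EndomorphismRingsAbelianSurfaces, Remark 14 (p. 299)] -/
instance (d : ℕ) (t : ℤ × ℤ × ℤ) : Decidable (IsQCMReduced d t) :=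
  inferInstanceAs (Decidable (0 < t.1 ∧ 0 ≤ t.2.1 ∧ 2 * t.2.1 ≤ t.1 ∧ t.1 ≤ t.2.2 ∧
    t.1 * t.2.2 - t.2.1 ^ 2 = 4 * d ∧ (t.1 % 4 = 0 ∨ t.1 % 4 = 1) ∧ (t.2.2 % 4 = 0 ∨ t.2.2 % 4 = 1)))

/-- **Dictionary**: a triple is reduced admissible of determinant `4d` iff its matrix is a Runge-reduced discriminant
matrix with `Δ₁ > 0` and `det = 4d`. [cite: Runge1999EndomorphismRingsAbelianSurfaces, Remark 14 (p. 299)] -/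
theorem isQCMReduced_iff (d : ℕ) (a b c : ℤ) :
    IsQCMReduced d (a, b, c) ↔
      IsRungeReduced (symMat (a, b, c)) ∧ IsDiscMatrix (symMat (a, b, c)) ∧ 0 < a ∧
        (symMat (a, b, c)).det = 4 * d := by
  have hdet : (symMat (a, b, c)).det = a * c - b ^ 2 := by rw [symMat, Matrix.det_fin_two_of]; ring
  simp only [IsQCMReduced, IsRungeReduced, symMat, Matrix.of_apply, Matrix.cons_val', Matrix.cons_val_zero,
    Matrix.cons_val_one, Matrix.empty_val', Matrix.cons_val_fin_one]
  rw [symMat] at hdet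
  constructor
  · rintro ⟨h0, h1, h2, h3, h4, h5, h6⟩
    exact ⟨⟨h1, h2, h3⟩, ⟨by simp, by simpa using h5, by simpa using h6, by rw [hdet, h4]; exact dvd_mul_right 4 _⟩,
      h0, by rw [hdet, h4]⟩
  · rintro ⟨⟨h1, h2, h3⟩, hD, h0, h4⟩
    refine ⟨h0, h1, h2, h3, by rw [← hdet, h4], ?_, ?_⟩
    · simpa using hD.fst_emod_four
    · simpa using hD.snd_emod_four

/-- The search bound `⌊√(16d/3)⌋` for `Δ₁` (the tree's `BinQF.bndAux`: the largest `k ≤ 16d` with `3k² ≤ 16d`).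
[cite: Runge1999EndomorphismRingsAbelianSurfaces, Remark 14 (p. 299: "`3Δ₁² ≤ 16d`")] -/
def qcmBound (d : ℕ) : ℕ := BinQF.bndAux (16 * d) (16 * d)

/-- `Δ₁ ≤ qcmBound d` for a reduced admissible triple. [cite: Runge1999EndomorphismRingsAbelianSurfaces, Remark 14 (p. 299)] -/
theorem fst_le_qcmBound {d : ℕ} {t : ℤ × ℤ × ℤ} (h : IsQCMReduced d t) : t.1 ≤ qcmBound d := by
  obtain ⟨h0, h1, h2, h3, h4, -, -⟩ := h
  have key : 3 * (t.1 * t.1) ≤ 16 * d := by nlinarith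
  have hnat : 3 * (t.1.toNat * t.1.toNat) ≤ 16 * d := by
    have e : (t.1.toNat : ℤ) = t.1 := Int.toNat_of_nonneg h0.le
    have : ((3 * (t.1.toNat * t.1.toNat) : ℕ) : ℤ) ≤ ((16 * d : ℕ) : ℤ) := by push_cast; rw [e]; exact key
    exact_mod_cast this
  have hle : t.1.toNat ≤ qcmBound d := BinQF.le_bndAux hnat (by nlinarith)
  omega

/-- The candidate triple with `Δ₁ = i`, `Δ = j`, `Δ₂ = (j² + 4d)/i` (enumeration). [folklore] -/
private def qcmCandidate (d i j : ℕ) : ℤ × ℤ × ℤ := ((i : ℤ), (j : ℤ), (((j : ℤ) ^ 2 + 4 * d) / (i : ℤ)))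

/-- All candidates with `Δ₁, Δ ≤ qcmBound d` (enumeration). [folklore] -/
private def qcmCandidates (d : ℕ) : List (ℤ × ℤ × ℤ) :=
  (List.range (qcmBound d + 1)).flatMap fun i : ℕ ↦ (List.range (qcmBound d + 1)).map fun j : ℕ ↦ qcmCandidate d i j

/-- **The list of Runge-reduced admissible discriminant matrices of determinant `4d`** (complete and duplicate-free:
`mem_qcmReducedList_iff`, `nodup_qcmReducedList`; evaluated by `decide`). [cite: Runge1999EndomorphismRingsAbelianSurfaces, Remark 14 (p. 299)] -/
def qcmReducedList (d : ℕ) : List (ℤ × ℤ × ℤ) := (qcmCandidates d).filter fun t ↦ decide (IsQCMReduced d t)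

/-- **`h_QCM(d)`** — the number of reduced admissible discriminant matrices of determinant `4d` (by §3–§4: the number
of `Gl(2, ℤ)`-classes of positive definite discriminant matrices of determinant `4d`, `existsUnique_isGLEquiv_of_isDiscMatrix`).
[cite: Runge1999EndomorphismRingsAbelianSurfaces, Remark 14 (p. 299)] -/
def qcmClassNumber (d : ℕ) : ℕ := (qcmReducedList d).length

/-- **`h_QCM,primitive(d)`** — the number of PRIMITIVE reduced admissible matrices of determinant `4d`.
[cite: Runge1999EndomorphismRingsAbelianSurfaces, Remark 14 (p. 299)] -/
def qcmPrimitiveClassNumber (d : ℕ) : ℕ :=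
  ((qcmReducedList d).filter fun t ↦ decide (IsPrimitiveDisc (symMat t))).length

/-- Every reduced admissible triple is a candidate (enumeration). [folklore] -/
private theorem mem_qcmCandidates {d : ℕ} {t : ℤ × ℤ × ℤ} (h : IsQCMReduced d t) : t ∈ qcmCandidates d := by
  have hb := fst_le_qcmBound h
  obtain ⟨a, b, c⟩ := t
  obtain ⟨h0, h1, h2, h3, h4, -, -⟩ := h
  simp only at h0 h1 h2 h3 h4 hb
  simp only [qcmCandidates, List.mem_flatMap, List.mem_map, List.mem_range]
  refine ⟨a.toNat, by omega, b.toNat, by omega, ?_⟩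
  simp only [qcmCandidate, Prod.mk.injEq]
  refine ⟨by omega, by omega, ?_⟩
  have ea : ((a.toNat : ℕ) : ℤ) = a := by omega
  have eb : ((b.toNat : ℕ) : ℤ) = b := by omega
  rw [ea, eb, show b ^ 2 + 4 * (d : ℤ) = a * c by linarith, Int.mul_ediv_cancel_left _ h0.ne']

/-- **Completeness of the list.** [cite: Runge1999EndomorphismRingsAbelianSurfaces, Remark 14 (p. 299)] -/
theorem mem_qcmReducedList_iff {d : ℕ} {t : ℤ × ℤ × ℤ} : t ∈ qcmReducedList d ↔ IsQCMReduced d t := by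
  simp only [qcmReducedList, List.mem_filter, decide_eq_true_eq]
  exact ⟨fun h ↦ h.2, fun h ↦ ⟨mem_qcmCandidates h, h⟩⟩

/-- Distinct indices give distinct candidates (enumeration). [folklore] -/
private theorem qcmCandidate_injective {d i j i' j' : ℕ} (h : qcmCandidate d i j = qcmCandidate d i' j') : i = i' ∧ j = j' := by
  simp only [qcmCandidate, Prod.mk.injEq] at h
  exact ⟨by exact_mod_cast h.1, by exact_mod_cast h.2.1⟩

/-- The candidate list has no duplicates (enumeration). [folklore] -/
private theorem nodup_qcmCandidates (d : ℕ) : (qcmCandidates d).Nodup := by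
  rw [qcmCandidates, List.nodup_flatMap]
  constructor
  · intro i _
    exact (List.nodup_range).map fun j j' h ↦ (qcmCandidate_injective h).2
  · refine (List.nodup_range).pairwise_of_forall_ne fun i _ i' _ hii' ↦ ?_
    rw [Function.onFun, List.disjoint_left]
    intro t ht ht'
    rw [List.mem_map] at ht ht'
    obtain ⟨j, -, rfl⟩ := ht
    obtain ⟨j', -, h⟩ := ht'
    exact hii' (qcmCandidate_injective h.symm).1

/-- `qcmReducedList d` has no duplicates (so `qcmClassNumber d` IS the number of reduced matrices).
[cite: Runge1999EndomorphismRingsAbelianSurfaces, Remark 14 (p. 299)] -/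
theorem nodup_qcmReducedList (d : ℕ) : (qcmReducedList d).Nodup := (nodup_qcmCandidates d).filter _

/-- `h_QCM(d)` as the cardinality of a finite set. [cite: Runge1999EndomorphismRingsAbelianSurfaces, Remark 14 (p. 299)] -/
theorem qcmClassNumber_eq_card (d : ℕ) : qcmClassNumber d = (qcmReducedList d).toFinset.card := by
  rw [qcmClassNumber, List.toFinset_card_of_nodup (nodup_qcmReducedList d)]

/-- **THE CLASSIFICATION behind `h_QCM(d)`: every positive discriminant matrix (`Δ₁ > 0`) of determinant `4d` is
`Gl(2, ℤ)`-equivalent to EXACTLY ONE matrix of `qcmReducedList d`.** [cite: Runge1999EndomorphismRingsAbelianSurfaces, Remark 14 (p. 299)] -/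
theorem existsUnique_isGLEquiv_of_isDiscMatrix {S : M₂ℤ} {d : ℕ} (hD : IsDiscMatrix S) (ha : 0 < S 0 0)
    (hd : S.det = 4 * d) (hdpos : 0 < d) :
    ∃! t, t ∈ qcmReducedList d ∧ IsGLEquiv S (symMat t) := by
  have hdet : 0 < S.det := by rw [hd]; positivity
  obtain ⟨S', hequiv, hsymm, ha', hred⟩ := exists_isGLEquiv_isRungeReduced hD.symm ha hdet
  have hD' : IsDiscMatrix S' := hequiv.isDiscMatrix hD
  refine ⟨(S' 0 0, S' 0 1, S' 1 1), ⟨?_, by rw [symMat_entries hsymm]; exact hequiv⟩, ?_⟩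
  · rw [mem_qcmReducedList_iff, isQCMReduced_iff, symMat_entries hsymm]
    exact ⟨hred, hD', ha', by rw [hequiv.det_eq, hd]⟩
  · rintro ⟨a, b, c⟩ ⟨hmem, hequiv'⟩
    rw [mem_qcmReducedList_iff, isQCMReduced_iff] at hmem
    obtain ⟨hred', hDt, -, -⟩ := hmem
    have hSS : IsGLEquiv S' (symMat (a, b, c)) := hequiv.symm.trans hequiv'
    have heq := eq_of_isGLEquiv_of_isRungeReduced hsymm hred hred' hSS
    refine Prod.ext ?_ (Prod.ext ?_ ?_) <;> simp [heq, symMat]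

/-- **Runge's table, third row: `h_QCM(d) = 1, 1, 2, 3, 2, 2, 2, 3, 3, 2, 3` for `d = 1, …, 11`** (by `decide`).
[cite: Runge1999EndomorphismRingsAbelianSurfaces, Remark 14 (p. 299, table)] -/
theorem qcmClassNumber_table :
    (List.range 11).map (fun i ↦ qcmClassNumber (i + 1)) = [1, 1, 2, 3, 2, 2, 2, 3, 3, 2, 3] := by
  decide

/-- **Runge's table, first row: `h_QCM,primitive(d) = 1, 1, 1, 2, 2, 2, 1, 2, 3, 2, 2` for `d = 1, …, 11`** (by `decide`).
[cite: Runge1999EndomorphismRingsAbelianSurfaces, Remark 14 (p. 299, table)] -/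
theorem qcmPrimitiveClassNumber_table :
    (List.range 11).map (fun i ↦ qcmPrimitiveClassNumber (i + 1)) = [1, 1, 1, 2, 2, 2, 1, 2, 3, 2, 2] := by
  decide

/-- **The reduced matrices themselves, `d = 1, …, 11`** (as `(Δ₁, Δ, Δ₂)`; by `decide`).
[cite: Runge1999EndomorphismRingsAbelianSurfaces, Remark 14 (p. 299)] -/
theorem qcmReducedList_eq :
    (List.range 11).map (fun i ↦ qcmReducedList (i + 1)) =
      [[(1, 0, 4)], [(1, 0, 8)], [(1, 0, 12), (4, 2, 4)], [(1, 0, 16), (4, 0, 4), (4, 2, 5)],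
        [(1, 0, 20), (4, 0, 5)], [(1, 0, 24), (5, 1, 5)], [(1, 0, 28), (4, 2, 8)],
        [(1, 0, 32), (4, 0, 8), (4, 2, 9)], [(1, 0, 36), (4, 0, 9), (5, 2, 8)], [(1, 0, 40), (5, 0, 8)],
        [(1, 0, 44), (4, 2, 12), (5, 1, 9)]] := by
  decide

/-- `d = 6`: the classes are `(1 0; 0 24)` and `(5 1; 1 5)`. [cite: Runge1999EndomorphismRingsAbelianSurfaces, Remark 14 (p. 299)] -/
theorem qcmReducedList_six : qcmReducedList 6 = [(1, 0, 24), (5, 1, 5)] := by decide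

/-- `d = 10`: the classes are `(1 0; 0 40)` and `(5 0; 0 8)`. [cite: Runge1999EndomorphismRingsAbelianSurfaces, Remark 14 (p. 299)] -/
theorem qcmReducedList_ten : qcmReducedList 10 = [(1, 0, 40), (5, 0, 8)] := by decide

end Enumeration

/-! ## §6 The simple classes for `d ≤ 11`: `(5 1; 1 5)` (`d = 6`) and `(5 0; 0 8)` (`d = 10`) -/

section Simple

/-- Residues: `5x² + 2xy + 5y² ≡ m² (mod 3)` forces `3 ∣ m` and `x ≡ y (mod 3)` (checked on `ZMod 3`) (finite check). [folklore] -/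
private theorem key_mod_three :
    ∀ x y m : ZMod 3, 5 * x ^ 2 + 2 * x * y + 5 * y ^ 2 = m ^ 2 → m = 0 ∧ x = y := by decide

/-- Residues: `5x² + 8y² ≡ m² (mod 5)` forces `5 ∣ y` and `5 ∣ m` (checked on `ZMod 5`) (finite check). [folklore] -/
private theorem key_mod_five :
    ∀ x y m : ZMod 5, 5 * x ^ 2 + 8 * y ^ 2 = m ^ 2 → y = 0 ∧ m = 0 := by decide

/-- `5` is prime in `ℤ` (primes). [folklore] -/
private theorem int_prime_five : Prime (5 : ℤ) := Int.prime_ofNat_iff.mpr Nat.prime_five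

/-- **Descent at `3`: `5x² + 2xy + 5y² = m²` has only the zero solution.** [cite: Runge1999EndomorphismRingsAbelianSurfaces, Remark 14 (p. 299: `h_QCM,simple(6) = 1`)] -/
theorem eq_zero_of_five_one_five {x y m : ℤ} (h : 5 * x ^ 2 + 2 * x * y + 5 * y ^ 2 = m ^ 2) : x = 0 ∧ y = 0 := by
  suffices H : ∀ (n : ℕ) (x y m : ℤ), m.natAbs ≤ n → 5 * x ^ 2 + 2 * x * y + 5 * y ^ 2 = m ^ 2 → x = 0 ∧ y = 0 from
    H _ x y m le_rfl h
  intro n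
  induction n with
  | zero =>
    intro x y m hm h
    have hm0 : m = 0 := by omega
    subst hm0
    constructor <;> nlinarith [sq_nonneg (x + y), sq_nonneg x, sq_nonneg y]
  | succ n ih =>
    intro x y m hm h
    by_cases hm0 : m = 0
    · subst hm0; constructor <;> nlinarith [sq_nonneg (x + y), sq_nonneg x, sq_nonneg y]
    -- cast to `ZMod 3`
    have hmod : (m : ZMod 3) = 0 ∧ (x : ZMod 3) = (y : ZMod 3) := by
      apply key_mod_three
      have := congrArg (Int.cast : ℤ → ZMod 3) h
      push_cast at this
      exact this
    have h3m : (3 : ℤ) ∣ m := (ZMod.intCast_zmod_eq_zero_iff_dvd m 3).1 hmod.1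
    have h3xy : (3 : ℤ) ∣ y - x := (ZMod.intCast_eq_intCast_iff_dvd_sub x y 3).1 hmod.2
    obtain ⟨m₁, hm₁⟩ := h3m
    obtain ⟨z, hz⟩ := h3xy
    have hy' : y = x + 3 * z := by linarith
    -- `P(x, x + 3z) = 12x² + 36xz + 45z² = 9m₁²` ⟹ `3 ∣ 4x²` ⟹ `3 ∣ x`
    have h9 : 12 * x ^ 2 + 36 * x * z + 45 * z ^ 2 = 9 * m₁ ^ 2 := by
      rw [hy', hm₁] at h; linarith [h]
    have h3x2 : (3 : ℤ) ∣ x ^ 2 := ⟨m₁ ^ 2 - 4 * x * z - 5 * z ^ 2 - x ^ 2, by linarith⟩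
    have h3x : (3 : ℤ) ∣ x := Int.prime_three.dvd_of_dvd_pow h3x2
    obtain ⟨x₁, hx₁⟩ := h3x
    have hy₁ : y = 3 * (x₁ + z) := by rw [hy', hx₁]; ring
    -- descend: `P(x₁, x₁ + z) = m₁²`
    have h' : 5 * x₁ ^ 2 + 2 * x₁ * (x₁ + z) + 5 * (x₁ + z) ^ 2 = m₁ ^ 2 := by
      rw [hx₁, hy₁, hm₁] at h; linarith
    have hm₁lt : m₁.natAbs ≤ n := by
      have : m.natAbs = 3 * m₁.natAbs := by rw [hm₁, Int.natAbs_mul]; rfl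
      omega
    obtain ⟨hx0, hz0⟩ := ih x₁ (x₁ + z) m₁ hm₁lt h'
    constructor
    · rw [hx₁, hx0]; ring
    · rw [hy₁, hz0]; ring

/-- **Descent at `5`: `5x² + 8y² = m²` has only the zero solution.** [cite: Runge1999EndomorphismRingsAbelianSurfaces, Remark 14 (p. 299: `h_QCM,simple(10) = 1`)] -/
theorem eq_zero_of_five_zero_eight {x y m : ℤ} (h : 5 * x ^ 2 + 8 * y ^ 2 = m ^ 2) : x = 0 ∧ y = 0 := by
  suffices H : ∀ (n : ℕ) (x y m : ℤ), m.natAbs ≤ n → 5 * x ^ 2 + 8 * y ^ 2 = m ^ 2 → x = 0 ∧ y = 0 from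
    H _ x y m le_rfl h
  intro n
  induction n with
  | zero =>
    intro x y m hm h
    have hm0 : m = 0 := by omega
    subst hm0
    constructor <;> nlinarith [sq_nonneg x, sq_nonneg y]
  | succ n ih =>
    intro x y m hm h
    by_cases hm0 : m = 0
    · subst hm0; constructor <;> nlinarith [sq_nonneg x, sq_nonneg y]
    have hmod : (y : ZMod 5) = 0 ∧ (m : ZMod 5) = 0 := by
      apply key_mod_five (x : ZMod 5)
      have := congrArg (Int.cast : ℤ → ZMod 5) h
      push_cast at this
      exact this
    have h5y : (5 : ℤ) ∣ y := (ZMod.intCast_zmod_eq_zero_iff_dvd y 5).1 hmod.1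
    have h5m : (5 : ℤ) ∣ m := (ZMod.intCast_zmod_eq_zero_iff_dvd m 5).1 hmod.2
    obtain ⟨y₁, hy₁⟩ := h5y
    obtain ⟨m₁, hm₁⟩ := h5m
    -- `5x² + 200y₁² = 25m₁²` ⟹ `x² = 5(m₁² − 8y₁²)` ⟹ `5 ∣ x`
    have h5x2 : (5 : ℤ) ∣ x ^ 2 := ⟨m₁ ^ 2 - 8 * y₁ ^ 2, by rw [hy₁, hm₁] at h; linarith⟩
    have h5x : (5 : ℤ) ∣ x := int_prime_five.dvd_of_dvd_pow h5x2
    obtain ⟨x₁, hx₁⟩ := h5x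
    have h' : 5 * x₁ ^ 2 + 8 * y₁ ^ 2 = m₁ ^ 2 := by
      rw [hx₁, hy₁, hm₁] at h; linarith
    have hm₁lt : m₁.natAbs ≤ n := by
      have : m.natAbs = 5 * m₁.natAbs := by rw [hm₁, Int.natAbs_mul]; rfl
      omega
    obtain ⟨hx0, hy0⟩ := ih x₁ y₁ m₁ hm₁lt h'
    exact ⟨by rw [hx₁, hx0]; ring, by rw [hy₁, hy0]; ring⟩

/-- **The class `(5 1; 1 5)` (`d = 6`) is simple: `5x² + 2xy + 5y²` represents no non-zero square.**
[cite: Runge1999EndomorphismRingsAbelianSurfaces, Remark 14 (p. 299: `h_QCM,simple(6) = 1`)] -/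
theorem isSimpleDisc_five_one_five : IsSimpleDisc !![5, 1; 1, 5] := by
  intro x y m hm h
  have h' : 5 * x ^ 2 + 2 * x * y + 5 * y ^ 2 = m ^ 2 := by
    rw [← h, discBinForm]
    simp only [Matrix.of_apply, Matrix.cons_val', Matrix.cons_val_zero, Matrix.cons_val_one, Matrix.empty_val',
      Matrix.cons_val_fin_one]
    ring
  obtain ⟨rfl, rfl⟩ := eq_zero_of_five_one_five h'
  have hm2 : m ^ 2 = 0 := by rw [← h']; ring
  exact hm (pow_eq_zero_iff two_ne_zero |>.1 hm2)

/-- **The class `(5 0; 0 8)` (`d = 10`) is simple: `5x² + 8y²` represents no non-zero square.**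
[cite: Runge1999EndomorphismRingsAbelianSurfaces, Remark 14 (p. 299: `h_QCM,simple(10) = 1`)] -/
theorem isSimpleDisc_five_zero_eight : IsSimpleDisc !![5, 0; 0, 8] := by
  intro x y m hm h
  have h' : 5 * x ^ 2 + 8 * y ^ 2 = m ^ 2 := by
    rw [← h, discBinForm]
    simp only [Matrix.of_apply, Matrix.cons_val', Matrix.cons_val_zero, Matrix.cons_val_one, Matrix.empty_val',
      Matrix.cons_val_fin_one]
    ring
  obtain ⟨rfl, rfl⟩ := eq_zero_of_five_zero_eight h'
  have hm2 : m ^ 2 = 0 := by rw [← h']; ring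
  exact hm (pow_eq_zero_iff two_ne_zero |>.1 hm2)

/-- A small witness of non-simplicity: the form takes a value in `{1, 4, 9}` at some `(x, y) ∈ {−1, 0, 1}²`
(decidable; the witnesses behind the printed zeros of `h_QCM,simple`). [cite: Runge1999EndomorphismRingsAbelianSurfaces, Remark 14 (p. 299)] -/
def HasSmallSquare (t : ℤ × ℤ × ℤ) : Prop :=
  ∃ x ∈ ({-1, 0, 1} : Finset ℤ), ∃ y ∈ ({-1, 0, 1} : Finset ℤ), ∃ m ∈ ({1, 2, 3} : Finset ℤ),
    discBinForm (symMat t) x y = m ^ 2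

/-- `HasSmallSquare` is decidable (bounded quantifiers over finsets). [cite: Runge1999EndomorphismRingsAbelianSurfaces, Remark 14 (p. 299)] -/
instance (t : ℤ × ℤ × ℤ) : Decidable (HasSmallSquare t) := by
  unfold HasSmallSquare; infer_instance

/-- A small square witness refutes simplicity. [cite: Runge1999EndomorphismRingsAbelianSurfaces, Remark 14 (p. 299)] -/
theorem not_isSimpleDisc_of_hasSmallSquare {t : ℤ × ℤ × ℤ} (h : HasSmallSquare t) : ¬ IsSimpleDisc (symMat t) := by
  obtain ⟨x, -, y, -, m, hm, e⟩ := h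
  have hm0 : m ≠ 0 := by
    simp only [Finset.mem_insert, Finset.mem_singleton] at hm
    rcases hm with rfl | rfl | rfl <;> norm_num
  exact not_isSimpleDisc_of_eq_sq hm0 e

/-- For `d = 1, …, 11`, every listed reduced matrix other than `(5,1,5)` and `(5,0,8)` represents `1`, `4` or `9`
(by `decide`). [cite: Runge1999EndomorphismRingsAbelianSurfaces, Remark 14 (p. 299, table)] -/
theorem hasSmallSquare_of_mem_qcmReducedList :
    ∀ i ∈ List.range 11, ∀ t ∈ qcmReducedList (i + 1), t = (5, 1, 5) ∨ t = (5, 0, 8) ∨ HasSmallSquare t := by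
  decide

/-- **Runge's table, second row (`h_QCM,simple = 0 0 0 0 0 1 0 0 0 1 0`): for `1 ≤ d ≤ 11` a reduced admissible
matrix of determinant `4d` is simple iff it is `(5 1; 1 5)` (`d = 6`) or `(5 0; 0 8)` (`d = 10`).**
[cite: Runge1999EndomorphismRingsAbelianSurfaces, Remark 14 (p. 299, table)] -/
theorem isSimpleDisc_iff_of_mem_qcmReducedList {d : ℕ} (hd : 1 ≤ d) (hd' : d ≤ 11) {t : ℤ × ℤ × ℤ}
    (ht : t ∈ qcmReducedList d) : IsSimpleDisc (symMat t) ↔ t = (5, 1, 5) ∨ t = (5, 0, 8) := by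
  have hi : d - 1 ∈ List.range 11 := by rw [List.mem_range]; omega
  have hd1 : d - 1 + 1 = d := by omega
  have H := hasSmallSquare_of_mem_qcmReducedList (d - 1) hi t (by rw [hd1]; exact ht)
  constructor
  · intro hs
    rcases H with h | h | h
    · exact Or.inl h
    · exact Or.inr h
    · exact absurd hs (not_isSimpleDisc_of_hasSmallSquare h)
  · rintro (rfl | rfl)
    · exact isSimpleDisc_five_one_five
    · exact isSimpleDisc_five_zero_eight

/-- **Simplicity of an arbitrary positive discriminant matrix with `det = 4d`, `d ≤ 11`, read off its reduced
representative.** [cite: Runge1999EndomorphismRingsAbelianSurfaces, Remark 14 (p. 299)] -/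
theorem isSimpleDisc_iff_of_isDiscMatrix {S : M₂ℤ} {d : ℕ} (hD : IsDiscMatrix S) (ha : 0 < S 0 0)
    (hd : S.det = 4 * d) (hd1 : 1 ≤ d) (hd' : d ≤ 11) :
    IsSimpleDisc S ↔ IsGLEquiv S !![5, 1; 1, 5] ∨ IsGLEquiv S !![5, 0; 0, 8] := by
  obtain ⟨t, ⟨ht, hequiv⟩, huniq⟩ := existsUnique_isGLEquiv_of_isDiscMatrix hD ha hd (by omega)
  rw [← hequiv.isSimpleDisc_iff hD.symm, isSimpleDisc_iff_of_mem_qcmReducedList hd1 hd' ht]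
  constructor
  · rintro (rfl | rfl)
    · exact Or.inl hequiv
    · exact Or.inr hequiv
  · rintro (h | h)
    · have hd6 : d = 6 := by
        have := h.det_eq; rw [hd, Matrix.det_fin_two_of] at this; omega
      subst hd6
      have hmem : ((5 : ℤ), (1 : ℤ), (5 : ℤ)) ∈ qcmReducedList 6 := by rw [qcmReducedList_six]; simp
      exact Or.inl (huniq _ ⟨hmem, h⟩ ▸ rfl)
    · have hd10 : d = 10 := by
        have := h.det_eq; rw [hd, Matrix.det_fin_two_of] at this; omega
      subst hd10
      have hmem : ((5 : ℤ), (0 : ℤ), (8 : ℤ)) ∈ qcmReducedList 10 := by rw [qcmReducedList_ten]; simp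
      exact Or.inr (huniq _ ⟨hmem, h⟩ ▸ rfl)

end Simple

end SiegelModuli

end Literature.AlgebraicGeometry.ModuliOfAbelianVarieties
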